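import Summits.MatrixMultiplication.MatrixMultiplication.Theses.FourierTwoFamiliesModP
import Summits.MatrixMultiplication.MatrixMultiplication.Theses.EisensteinValCertificates
import Summits.MatrixMultiplication.MatrixMultiplication.Theorems.PrimeLogDecay.Negative.LoadBearing
import Literature.Computability.AlgebraicComplexity.SimultaneousDoubleProduct
import Literature.Computability.AlgebraicComplexity.PrattTrapezoidValSTPP
import Literature.Computability.AlgebraicComplexity.PrattTrapezoidValProofs

/-!
# Disproof of `PrimeTwoFamilies` (stmt-MatrixMultiplication-14308) — the crux disprover's work file

Crux (route FourierTwoFamiliesModP, rank 0): CKSU 2005 Conj. 4.7 ("two families") with PRIME CYCLIC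
hosts — `∀ δ > 0`, for arbitrarily large `n`, a prime `p ≤ n^{2+δ}` and `n` SDPP pairs `(Aᵢ, Bᵢ)` in `ℤ/p`
with `|Aᵢ||Bᵢ| ≥ n^{2-δ}`.  An OPEN CONJECTURE in print (arXiv:math/0511460 "Conjecture 26", Pratt
arXiv:2309.03878 Conj. 2.5 + p. 10: by Umans' cyclic reduction the prime-cyclic form loses nothing), so no
unconditional kill is expected; this file records, sorry-free, what a disproof (or a witness) must respect.

FINDINGS (all theorems below are kernel-checked unless marked `sorry` in §5):
* §0 `PrimeTwoFamiliesAt δ` — the `δ`-slices (`primeTwoFamilies_iff : crux ↔ ∀ δ > 0, slice δ`,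
  by `Iff.rfl`); slices are monotone (`PrimeTwoFamiliesAt.mono`); the far slice `δ = 2` holds trivially
  (`primeTwoFamiliesAt_two`, singletons) — the content is the limit `δ → 0` only.
* §1 TIGHTNESS of the slack: the exact slice is false, `not_primeTwoFamiliesAt_zero` ((W) gives
  `|Aᵢ||Bᵢ| ≤ p`, so `p = n²` would be a prime square).  Nothing sharper is available by counting: CKSU
  Prop. 4.6/"25" (`α ≤ β`, `α + 2 ≤ 2β`) and the route's HalfDensity (`2ns² ≤ p(s+1)`) are all
  consistent with every slice `δ > 0` (a witness has density `ns/p ≈ n^{-3δ/2}` and `s²/p ≈ n^{-2δ}`).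
* §2 REFUTED STRENGTHENING / STRUCTURE OF WITNESSES — shape diversity on EACH side: if the
  `B`-sides (or the `A`-sides) of a witness of slice `δ` are translates of at most `K` templates then
  `n^{1-2δ} ≤ K` (`rpow_le_rightShapes_of_witness` / `…leftShapes…`; engine
  `sum_card_mul_card_le_of_rightClass`: one right class packs, `(Σ_{i∈S}|Aᵢ|)·|B₀| ≤ p`, by (X) at
  `(i,k,k)` + (W); SDPP symmetry `isSDPP_swap`).  Hence `not_rightShapedPrimeTwoFamiliesAt`: for
  `δ < 1/2` NO bounded number of one-sided shapes works — translate designs (`K = 1`, which do realise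
  every `δ > 1/2`), CKSU's trivial example (singleton `Bᵢ`) and every bounded-menu design are excluded;
  a witness near `δ → 0` needs `n^{1-o(1)}` pairwise non-translate sets among the `Aᵢ` AND among the `Bᵢ`.
  §2b PATTERN POVERTY: more generally a common translated SUB-pattern packs
  (`sum_card_mul_card_le_of_subshape`: `u i +ᵥ B₀ ⊆ B i` for all `i` ⇒ `(Σ|Aᵢ|)·|B₀| ≤ p`), and with the
  Cauchy–Schwarz bound `n^{4-δ} ≤ (Σ|Aᵢ|)·p` (`rpow_le_sum_card_mul_of_witness`) every pattern common to
  all `Bᵢ` (or all `Aᵢ`) up to translation has size `≤ n^{3δ}` (`common_subshape_card_le_of_witness`):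
  the blocks of a witness near `δ → 0` share no progression / subcube of size `n^{Ω(1)}`... precisely `n^{3δ}`.
* §3 CONDITIONAL KILL (the route's kill criterion made precise and checked): the crux forces
  `Val(ℤ/P) ≥ P^{4/3-ε}` for infinitely many PRIMES `P` (`exists_prime_prattVal_ge_of_primeTwoFamilies`:
  CKSU §6 corner-free lift to `(ℤ/p)³`, tree `addSimultaneousTPP_of_sdpp` + Behrend, the tree's mixed-radix
  Freiman map into ANY modulus `N ≥ (3p)³` — `sum_card_mul_le_prattVal_zmod_of_addEquiv` — and Bertrand
  for a prime modulus), hence `primeTwoFamilies_false_of_primeFourThirdsSaving :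
  EisensteinValCertificates.PrimeFourThirdsSaving → ¬ PrimeTwoFamilies` (Pratt Thm 4.7 at primes; the
  sibling route's crux stmt-7790 is a sufficient kill) and `primeTwoFamilies_false_of_valSaving`
  (any `Val(ℤ/N) < N^{4/3-ε}` for all large `N`, via the tree theorem `pratt2024_thm47_holds`).
* §5 TIGHTNESS of §2 / the design baseline: `rightShapedPrimeTwoFamiliesAt_one` — for every `δ > 1/2`
  ONE shape suffices (translates `Aᵢ = i·s² + [0,s)`, `Bᵢ = i·s² + s·[0,s)`, `s = ⌈n^{1-δ/2}⌉`, Bertrand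
  prime `p ∈ (2ns², 4ns²]`; singletons for `δ ≥ 2`), so `primeTwoFamiliesAt_of_gt_half`: every slice
  `δ > 1/2` HOLDS and the threshold `1/2` of §2 is exact.  The crux's open range is `δ ∈ (0, 1/2]`
  by explicit designs in this file (digit designs reach `≈ 0.36`, not formalised as slices here).
* §6 LOAD-BEARING CLAUSES (dual form for an `∃`-statement): the crux with any ONE clause dropped is
  TRUE for every `δ > 0` — `primeTwoFamiliesWithoutSize_holds` (singletons), `…WithoutHost_holds`
  (translates at `p ≈ 4ns²`: host exponent `3 - δ`; the difficulty is exactly the exponent `2`),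
  `…WithoutX_holds` (one direct pair repeated, `p ≈ 2s²`), `…WithoutW_holds` (gapped blocks
  `Aᵢ = Bᵢ = 2iL + [0,L)`, `p ≈ 8nL`).  All four clauses jointly carry the content.
* §3c `primeTwoFamilies_false_of_primeCyclicPowerGain` — the route's kill link PowerGainRefutes
  (stmt-14312) PROVED here (Markov + shrink + reindex; `n^{c/2} ≤ 2·4^{1+c}`); candidate for the
  positive item attached to stmt-14312 (`folder/PGR.lean`), so `PrimeCyclicPowerGain` (stmt-14309) is
  now FORMALLY a sufficient kill of this crux.
* §4 WHY IT RESISTS (docstring): the only obstructions in print are Pratt's Val programme (its skew-corner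
  proxy is dead: Beker arXiv:2404.07380, Pohoata–Zakharov) and slice rank (vacuous in `ℤ/p`, exponent `p`);
  best designs known in `ℤ/p` sit at `δ ≈ 0.36–0.415` (radix-5/6 digit designs of the wall refutation,
  `(α, β) = (log₂ 3, log₂ 5)`), translates at `δ = 1/2`; the all-abelian record is `δ ≈ 0.18`
  (CKSU Prop. "24" in `(ℤ/4)^{2l} × (ℤ/5)^{2l'}`).  No inequality known excludes any `δ > 0`.
-/

namespace Summit.MatrixMultiplication.MatrixMultiplication.Cruxes.PrimeTwoFamilies.Disproof

open Finset
open Summit.MatrixMultiplication.MatrixMultiplication.Theses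
open Literature.Computability.AlgebraicComplexity

/-! ## §0 The `δ`-slices of the crux -/

/-- The `δ`-slice of the crux `PrimeTwoFamilies` (the crux is `∀ δ > 0, PrimeTwoFamiliesAt δ`,
`primeTwoFamilies_iff`): arbitrarily large `n`, a prime `p ≤ n^{2+δ}` and `n` SDPP pairs in `ℤ/p`
with `|A_i||B_i| ≥ n^{2-δ}`.  In CKSU's `(α, β)`-language (arXiv:math/0511460 p. 8) a witness is a
design with `α ≥ 2 - δ` and `β ≤ 2 + δ`. -/
def PrimeTwoFamiliesAt (δ : ℝ) : Prop :=
  ∀ n₀ : ℕ, ∃ n ≥ n₀, ∃ p : ℕ, p.Prime ∧ ∃ A B : Fin n → Finset (ZMod p),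
    (∀ i : Fin n, ∀ a ∈ A i, ∀ a' ∈ A i, ∀ b ∈ B i, ∀ b' ∈ B i,
        (a - a') + (b - b') = 0 → a = a' ∧ b = b') ∧
    (∀ i j k : Fin n, ∀ a ∈ A i, ∀ a' ∈ A j, ∀ b ∈ B j, ∀ b' ∈ B k,
        (a - a') + (b - b') = 0 → i = k) ∧
    (p : ℝ) ≤ (n : ℝ) ^ (2 + δ) ∧
    ∀ i : Fin n, (n : ℝ) ^ (2 - δ) ≤ (((A i).card * (B i).card : ℕ) : ℝ)

/-- The crux is the conjunction of its positive slices (definitional). -/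
theorem primeTwoFamilies_iff :
    FourierTwoFamiliesModP.PrimeTwoFamilies ↔ ∀ δ : ℝ, 0 < δ → PrimeTwoFamiliesAt δ :=
  Iff.rfl

/-- Slices are monotone in `δ`. -/
theorem PrimeTwoFamiliesAt.mono {δ δ' : ℝ} (h : PrimeTwoFamiliesAt δ) (hδ : δ ≤ δ') :
    PrimeTwoFamiliesAt δ' := by
  intro n₀
  obtain ⟨n, hn, p, hp, A, B, hW, hX, hpn, hAB⟩ := h (n₀ + 1)
  have hn1 : (1 : ℝ) ≤ n := by exact_mod_cast (show 1 ≤ n by omega)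
  refine ⟨n, by omega, p, hp, A, B, hW, hX, ?_, fun i => ?_⟩
  · exact hpn.trans (Real.rpow_le_rpow_of_exponent_le hn1 (by linarith))
  · exact (Real.rpow_le_rpow_of_exponent_le hn1 (by linarith)).trans (hAB i)

/-- The far slice `δ = 2` holds trivially (singletons `A_i = B_i = {i}` in `ℤ/p`, `n = p`):
the content of the crux is the limit `δ → 0`, not any fixed slice. -/
theorem primeTwoFamiliesAt_two : PrimeTwoFamiliesAt 2 := by
  intro n₀
  obtain ⟨p, hn₀p, hp⟩ := Nat.exists_infinite_primes (n₀ + 2)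
  haveI : Fact p.Prime := ⟨hp⟩
  refine ⟨p, by omega, p, hp, fun i => {((i : ℕ) : ZMod p)}, fun i => {((i : ℕ) : ZMod p)},
    ?_, ?_, ?_, ?_⟩
  · intro i a ha a' ha' b hb b' hb' _
    rw [mem_singleton] at ha ha' hb hb'
    exact ⟨ha.trans ha'.symm, hb.trans hb'.symm⟩
  · intro i j k a ha a' ha' b hb b' hb' h0
    rw [mem_singleton] at ha ha' hb hb'
    subst ha ha' hb hb'
    have h1 : ((i : ℕ) : ZMod p) = ((k : ℕ) : ZMod p) := by
      have : ((i : ℕ) : ZMod p) - ((k : ℕ) : ZMod p) = 0 := by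
        rw [← h0]; abel
      exact sub_eq_zero.1 this
    rw [ZMod.natCast_eq_natCast_iff'] at h1
    rw [Nat.mod_eq_of_lt i.isLt, Nat.mod_eq_of_lt k.isLt] at h1
    exact Fin.ext h1
  · have hp1 : (1 : ℝ) ≤ p := by exact_mod_cast hp.one_lt.le
    calc (p : ℝ) = (p : ℝ) ^ (1 : ℝ) := (Real.rpow_one _).symm
      _ ≤ (p : ℝ) ^ (2 + (2 : ℝ)) := Real.rpow_le_rpow_of_exponent_le hp1 (by norm_num)
  · intro i
    simp only [card_singleton, sub_self, Real.rpow_zero]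
    norm_num

/-! ## §1 Tightness of the `δ`-slack -/

/-- **The exact slice `δ = 0` is false.**  A witness would have `n² ≤ |A_i||B_i| ≤ p ≤ n²` ((W)
makes `(a,b) ↦ a+b` injective on `A_i × B_i`, CKSU Prop. 4.6 `α ≤ β`, tree
`card_mul_card_le_of_dpp`), so the prime `p` would be the square `n²`, `n ≥ 2`. -/
theorem not_primeTwoFamiliesAt_zero : ¬ PrimeTwoFamiliesAt 0 := by
  intro h
  obtain ⟨n, hn, p, hp, A, B, hW, hX, hpn, hAB⟩ := h 2
  haveI : Fact p.Prime := ⟨hp⟩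
  have i : Fin n := ⟨0, by omega⟩
  have h1 : (A i).card * (B i).card ≤ p := by
    have := card_mul_card_le_of_dpp (H := ZMod p) (hW i)
    rwa [ZMod.card] at this
  have h2 : (n : ℝ) ^ (2 - (0 : ℝ)) = (n : ℝ) ^ 2 := by rw [sub_zero, Real.rpow_two]
  have h3 : (n : ℝ) ^ (2 + (0 : ℝ)) = (n : ℝ) ^ 2 := by rw [add_zero, Real.rpow_two]
  have h4 := hAB i
  rw [h2] at h4
  rw [h3] at hpn
  have h5 : (((A i).card * (B i).card : ℕ) : ℝ) ≤ (p : ℝ) := by exact_mod_cast h1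
  have h6 : (p : ℝ) = (n : ℝ) ^ 2 := le_antisymm hpn (h4.trans h5)
  have h7 : p = n ^ 2 := by exact_mod_cast h6
  have hdvd : n ∣ p := ⟨n, by rw [h7]; ring⟩
  rcases (Nat.dvd_prime hp).1 hdvd with h8 | h8
  · omega
  · subst h8
    have : n * n ≤ n * 1 := by nlinarith [h7]
    have := Nat.le_of_mul_le_mul_left this (by omega)
    omega

/-! ## §2 Structure of witnesses: shape diversity (refuted strengthening "few shapes") -/

section Shapes
open scoped Pointwise

variable {G : Type*} [AddCommGroup G] [DecidableEq G] {n : ℕ}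

omit [DecidableEq G] in
/-- The SDPP is symmetric in its two sides. -/
theorem isSDPP_swap {A B : Fin n → Finset G} (h : IsSDPP A B) : IsSDPP B A := by
  refine ⟨fun i b hb b' hb' a ha a' ha' h0 => ?_, fun i j k b hb b' hb' a ha a' ha' h0 => ?_⟩
  · have e : (a - a') + (b - b') = (b - b') + (a - a') := by abel
    have := h.1 i a ha a' ha' b hb b' hb' (by rw [e, h0])
    exact ⟨this.2, this.1⟩
  · have e : (a' - a) + (b' - b) = -((b - b') + (a - a')) := by abel
    exact (h.2 k j i a' ha' a ha b' hb' b hb (by rw [e, h0, neg_zero])).symm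

/-- The `B`-sides of the family use at most `K` SHAPES: every `B i` is a translate `u i +ᵥ B₀ c`
of one of `K` templates (`A`-sides arbitrary). -/
def UsesRightShapes (B : Fin n → Finset G) (K : ℕ) : Prop :=
  ∃ (B₀ : Fin K → Finset G) (c : Fin n → Fin K) (u : Fin n → G), ∀ i : Fin n, B i = u i +ᵥ B₀ (c i)

/-- The family `(A i, B i)_{i<n}` uses at most `K` (two-sided) SHAPES: every pair is a translate
`(t i +ᵥ A₀ c, u i +ᵥ B₀ c)` of one of `K` template pairs. -/
def UsesShapes (A B : Fin n → Finset G) (K : ℕ) : Prop :=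
  ∃ (A₀ B₀ : Fin K → Finset G) (c : Fin n → Fin K) (t u : Fin n → G),
    ∀ i : Fin n, A i = t i +ᵥ A₀ (c i) ∧ B i = u i +ᵥ B₀ (c i)

/-- Two-sided shapes are in particular right shapes. -/
theorem UsesShapes.right {A B : Fin n → Finset G} {K : ℕ} (h : UsesShapes A B K) :
    UsesRightShapes B K := by
  obtain ⟨_, B₀, c, _, u, hAB⟩ := h
  exact ⟨B₀, c, u, fun i => (hAB i).2⟩

/-- **A common translated sub-pattern packs**: if a translate `u i +ᵥ B₀` of one pattern `B₀` lies
inside `B i` for every `i ∈ S` (in an SDPP family), then `(a, b) ↦ a + b` is injective on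
`(⊔_{i∈S} A i) × B₀` — (X) at `(i, k, k)` separates the blocks (`a - a' = (u_k + b') - (u_k + b)` forces
`i = k`), (W) separates inside a block — so `(Σ_{i∈S} |A i|)·|B₀| ≤ |G|`. -/
theorem sum_card_mul_card_le_of_subshape [Fintype G] {A B : Fin n → Finset G} (h : IsSDPP A B)
    (S : Finset (Fin n)) (B₀ : Finset G) (u : Fin n → G) (hB : ∀ i ∈ S, u i +ᵥ B₀ ⊆ B i) :
    (∑ i ∈ S, (A i).card) * B₀.card ≤ Fintype.card G := by
  classical
  have memB : ∀ i ∈ S, ∀ b ∈ B₀, u i + b ∈ B i := fun i hi b hb =>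
    hB i hi (Finset.mem_vadd_finset.2 ⟨b, hb, rfl⟩)
  let f : (Σ _ : Fin n, G) × G → G := fun x => x.1.2 + x.2
  have hinj : Set.InjOn f ↑((S.sigma fun i => A i) ×ˢ B₀) := by
    rintro ⟨⟨i, a⟩, b⟩ hx ⟨⟨k, a'⟩, b'⟩ hy hxy
    simp only [Finset.coe_product, Set.mem_prod, Finset.mem_coe, Finset.mem_sigma] at hx hy
    obtain ⟨⟨hi, ha⟩, hb⟩ := hx
    obtain ⟨⟨hk, ha'⟩, hb'⟩ := hy
    simp only [f] at hxy
    have e : ∀ v : G, a - a' + (v + b - (v + b')) = (a + b) - (a' + b') := fun v => by abel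
    have hik : i = k :=
      h.2 i k k a ha a' ha' (u k + b) (memB k hk b hb) (u k + b') (memB k hk b' hb')
        (by rw [e, hxy, sub_self])
    subst hik
    obtain ⟨h1, h2⟩ := h.1 i a ha a' ha' (u i + b) (memB i hi b hb) (u i + b') (memB i hi b' hb')
      (by rw [e, hxy, sub_self])
    have hb2 : b = b' := add_left_cancel h2
    subst h1; subst hb2; rfl
  have := Finset.card_le_card_of_injOn f (fun _ _ => Finset.mem_univ _) hinj
  rwa [Finset.card_product, Finset.card_sigma, Finset.card_univ] at this

/-- **One right class packs** (the case of equality `B i = u i +ᵥ B₀`, `i ∈ S`):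
`(Σ_{i∈S} |A i|)·|B₀| ≤ |G|`.  Only the `B`-sides need to be translates of each other. -/
theorem sum_card_mul_card_le_of_rightClass [Fintype G] {A B : Fin n → Finset G} (h : IsSDPP A B)
    (S : Finset (Fin n)) (B₀ : Finset G) (u : Fin n → G) (hB : ∀ i ∈ S, B i = u i +ᵥ B₀) :
    (∑ i ∈ S, (A i).card) * B₀.card ≤ Fintype.card G :=
  sum_card_mul_card_le_of_subshape h S B₀ u fun i hi => by rw [hB i hi]

/-- **`K` right shapes pack `K` times**: an SDPP family whose `B`-sides use at most `K` shapes has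
`Σᵢ |Aᵢ||Bᵢ| ≤ K·|G|`. -/
theorem sum_card_mul_le_of_usesRightShapes [Fintype G] {K : ℕ} {A B : Fin n → Finset G}
    (h : IsSDPP A B) (hK : UsesRightShapes B K) :
    ∑ i, (A i).card * (B i).card ≤ K * Fintype.card G := by
  classical
  obtain ⟨B₀, c, u, hB⟩ := hK
  have hcard : ∀ i, (B i).card = (B₀ (c i)).card := fun i => by rw [hB i, Finset.card_vadd_finset]
  rw [← Finset.sum_fiberwise (Finset.univ : Finset (Fin n)) c (fun i => (A i).card * (B i).card)]
  have hclass : ∀ k : Fin K,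
      ∑ i ∈ (Finset.univ : Finset (Fin n)).filter (fun i => c i = k), (A i).card * (B i).card ≤
        Fintype.card G := by
    intro k
    have h1 : ∑ i ∈ (Finset.univ : Finset (Fin n)).filter (fun i => c i = k), (A i).card * (B i).card =
        (∑ i ∈ (Finset.univ : Finset (Fin n)).filter (fun i => c i = k), (A i).card) * (B₀ k).card := by
      rw [Finset.sum_mul]
      refine Finset.sum_congr rfl fun i hi => ?_
      rw [Finset.mem_filter] at hi
      rw [hcard i, hi.2]
    rw [h1]
    refine sum_card_mul_card_le_of_rightClass h _ (B₀ k) u fun i hi => ?_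
    rw [Finset.mem_filter] at hi
    rw [hB i, hi.2]
  calc ∑ k : Fin K, ∑ i ∈ (Finset.univ : Finset (Fin n)).filter (fun i => c i = k),
        (A i).card * (B i).card
      ≤ ∑ _k : Fin K, Fintype.card G := Finset.sum_le_sum fun k _ => hclass k
    _ = K * Fintype.card G := by
      rw [Finset.sum_const, Finset.card_univ, Fintype.card_fin, smul_eq_mul]

/-- The same for the `A`-sides (SDPP symmetry). -/
theorem sum_card_mul_le_of_usesLeftShapes [Fintype G] {K : ℕ} {A B : Fin n → Finset G}
    (h : IsSDPP A B) (hK : UsesRightShapes A K) :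
    ∑ i, (A i).card * (B i).card ≤ K * Fintype.card G := by
  have := sum_card_mul_le_of_usesRightShapes (isSDPP_swap h) hK
  simpa only [mul_comm] using this

/-- Two-sided version (corollary). -/
theorem sum_card_mul_le_of_usesShapes [Fintype G] {K : ℕ} {A B : Fin n → Finset G}
    (h : IsSDPP A B) (hK : UsesShapes A B K) :
    ∑ i, (A i).card * (B i).card ≤ K * Fintype.card G :=
  sum_card_mul_le_of_usesRightShapes h hK.right

/-- **Shape diversity of witnesses**: a configuration witnessing slice `δ` at level `n ≥ 1`
(prime `p ≤ n^{2+δ}`, SDPP, `|Aᵢ||Bᵢ| ≥ n^{2-δ}`) whose `B`-sides use at most `K` shapes has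
`n^{1-2δ} ≤ K`; by symmetry the same for the `A`-sides.  So witnesses of the crux near `δ → 0`
use `n^{1-o(1)}` pairwise non-translate sets on EACH side. -/
theorem rpow_le_rightShapes_of_witness {n p K : ℕ} (hp : p.Prime) (hn : 1 ≤ n) {δ : ℝ}
    {A B : Fin n → Finset (ZMod p)} (h : IsSDPP A B) (hK : UsesRightShapes B K)
    (hpn : (p : ℝ) ≤ (n : ℝ) ^ (2 + δ))
    (hAB : ∀ i : Fin n, (n : ℝ) ^ (2 - δ) ≤ (((A i).card * (B i).card : ℕ) : ℝ)) :
    (n : ℝ) ^ (1 - 2 * δ) ≤ K := by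
  haveI : Fact p.Prime := ⟨hp⟩
  have hsum := sum_card_mul_le_of_usesRightShapes h hK
  rw [ZMod.card] at hsum
  have hnpos : (0 : ℝ) < n := by exact_mod_cast hn
  have h1 : (n : ℝ) * (n : ℝ) ^ (2 - δ) ≤ (K : ℝ) * (n : ℝ) ^ (2 + δ) := by
    calc (n : ℝ) * (n : ℝ) ^ (2 - δ) = ∑ _i : Fin n, (n : ℝ) ^ (2 - δ) := by
          rw [Finset.sum_const, Finset.card_univ, Fintype.card_fin, nsmul_eq_mul]
      _ ≤ ∑ i : Fin n, (((A i).card * (B i).card : ℕ) : ℝ) := Finset.sum_le_sum fun i _ => hAB i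
      _ = ((∑ i : Fin n, (A i).card * (B i).card : ℕ) : ℝ) := by push_cast; rfl
      _ ≤ ((K * p : ℕ) : ℝ) := by exact_mod_cast hsum
      _ = (K : ℝ) * (p : ℝ) := by push_cast; rfl
      _ ≤ (K : ℝ) * (n : ℝ) ^ (2 + δ) := mul_le_mul_of_nonneg_left hpn (Nat.cast_nonneg K)
  have h2 : (n : ℝ) * (n : ℝ) ^ (2 - δ) = (n : ℝ) ^ (1 - 2 * δ) * (n : ℝ) ^ (2 + δ) := by
    rw [← Real.rpow_add hnpos, show (1 - 2 * δ + (2 + δ) : ℝ) = 1 + (2 - δ) by ring,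
      Real.rpow_add hnpos, Real.rpow_one]
  rw [h2] at h1
  exact le_of_mul_le_mul_right h1 (Real.rpow_pos_of_pos hnpos _)

/-- The `A`-side version of `rpow_le_rightShapes_of_witness`. -/
theorem rpow_le_leftShapes_of_witness {n p K : ℕ} (hp : p.Prime) (hn : 1 ≤ n) {δ : ℝ}
    {A B : Fin n → Finset (ZMod p)} (h : IsSDPP A B) (hK : UsesRightShapes A K)
    (hpn : (p : ℝ) ≤ (n : ℝ) ^ (2 + δ))
    (hAB : ∀ i : Fin n, (n : ℝ) ^ (2 - δ) ≤ (((A i).card * (B i).card : ℕ) : ℝ)) :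
    (n : ℝ) ^ (1 - 2 * δ) ≤ K :=
  rpow_le_rightShapes_of_witness hp hn (isSDPP_swap h) hK hpn
    (fun i => by rw [mul_comm]; exact hAB i)

/-- Two-sided corollary (the v1 statement). -/
theorem rpow_le_shapes_of_witness {n p K : ℕ} (hp : p.Prime) (hn : 1 ≤ n) {δ : ℝ}
    {A B : Fin n → Finset (ZMod p)} (h : IsSDPP A B) (hK : UsesShapes A B K)
    (hpn : (p : ℝ) ≤ (n : ℝ) ^ (2 + δ))
    (hAB : ∀ i : Fin n, (n : ℝ) ^ (2 - δ) ≤ (((A i).card * (B i).card : ℕ) : ℝ)) :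
    (n : ℝ) ^ (1 - 2 * δ) ≤ K :=
  rpow_le_rightShapes_of_witness hp hn h hK.right hpn hAB

/-- The "few right shapes" strengthening of slice `δ`: the slice, witnessed by families whose
`B`-sides use at most `K` shapes (translates of `K` templates; `A`-sides arbitrary). -/
def RightShapedPrimeTwoFamiliesAt (K : ℕ) (δ : ℝ) : Prop :=
  ∀ n₀ : ℕ, ∃ n ≥ n₀, ∃ p : ℕ, p.Prime ∧ ∃ A B : Fin n → Finset (ZMod p),
    UsesRightShapes B K ∧
    (∀ i : Fin n, ∀ a ∈ A i, ∀ a' ∈ A i, ∀ b ∈ B i, ∀ b' ∈ B i,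
        (a - a') + (b - b') = 0 → a = a' ∧ b = b') ∧
    (∀ i j k : Fin n, ∀ a ∈ A i, ∀ a' ∈ A j, ∀ b ∈ B j, ∀ b' ∈ B k,
        (a - a') + (b - b') = 0 → i = k) ∧
    (p : ℝ) ≤ (n : ℝ) ^ (2 + δ) ∧
    ∀ i : Fin n, (n : ℝ) ^ (2 - δ) ≤ (((A i).card * (B i).card : ℕ) : ℝ)

/-- The strengthening implies the slice. -/
theorem RightShapedPrimeTwoFamiliesAt.primeTwoFamiliesAt {K : ℕ} {δ : ℝ}
    (h : RightShapedPrimeTwoFamiliesAt K δ) : PrimeTwoFamiliesAt δ := by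
  intro n₀
  obtain ⟨n, hn, p, hp, A, B, -, hW, hX, hpn, hAB⟩ := h n₀
  exact ⟨n, hn, p, hp, A, B, hW, hX, hpn, hAB⟩

/-- **No bounded number of (one-sided) shapes reaches below `δ = 1/2`**: for every `K` and every
`δ < 1/2`, `¬ RightShapedPrimeTwoFamiliesAt K δ`.  In particular translate designs (`K = 1`; they do
realise every `δ > 1/2`: `A = [0,s)`, `B = s·[0,s)` shifted by multiples of `s²`), CKSU's trivial
example (`Bᵢ` singletons) and every bounded-menu design are stuck at `δ ≥ 1/2`. -/
theorem not_rightShapedPrimeTwoFamiliesAt (K : ℕ) {δ : ℝ} (hδ : δ < 1 / 2) :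
    ¬ RightShapedPrimeTwoFamiliesAt K δ := by
  intro h
  obtain ⟨n, hn, p, hp, A, B, hK, hW, hX, hpn, hAB⟩ := h (⌈((K : ℝ) + 1) ^ (1 / (1 - 2 * δ))⌉₊ + 1)
  have hn1 : 1 ≤ n := by omega
  have hle := rpow_le_rightShapes_of_witness hp hn1 ⟨hW, hX⟩ hK hpn hAB
  have hexp : 0 < 1 - 2 * δ := by linarith
  have hK1 : (0 : ℝ) ≤ (K : ℝ) + 1 := by positivity
  have hbase : ((K : ℝ) + 1) ^ (1 / (1 - 2 * δ)) < n := by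
    have h1 := Nat.le_ceil (((K : ℝ) + 1) ^ (1 / (1 - 2 * δ)))
    have h2 : (⌈((K : ℝ) + 1) ^ (1 / (1 - 2 * δ))⌉₊ : ℝ) < n := by exact_mod_cast hn
    linarith
  have hlt : (K : ℝ) + 1 < (n : ℝ) ^ (1 - 2 * δ) := by
    have h3 := Real.rpow_lt_rpow (Real.rpow_nonneg hK1 _) hbase hexp
    rwa [← Real.rpow_mul hK1, one_div_mul_cancel hexp.ne', Real.rpow_one] at h3
  linarith

/-! ### §2b Pattern poverty of witnesses -/

/-- **Witness packing lower bound** (Cauchy–Schwarz + pairwise disjointness of the `Bᵢ`): in a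
configuration with `n ≥ 1` SDPP pairs in `ℤ/p` and `|Aᵢ||Bᵢ| ≥ n^{2-δ}` one has
`n^{4-δ} ≤ (Σᵢ |Aᵢ|)·p` — since `n·n^{1-δ/2} ≤ Σ √|Aᵢ|√|Bᵢ| ≤ √(Σ|Aᵢ|)·√(Σ|Bᵢ|)` and `Σ|Bᵢ| ≤ p`.
So `Σ|Aᵢ| ≥ n^{2-2δ}` for witnesses of slice `δ` (and symmetrically for `Σ|Bᵢ|`). -/
theorem rpow_le_sum_card_mul_of_witness {n p : ℕ} (hp : p.Prime) (hn : 1 ≤ n) {δ : ℝ}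
    {A B : Fin n → Finset (ZMod p)} (h : IsSDPP A B)
    (hAB : ∀ i : Fin n, (n : ℝ) ^ (2 - δ) ≤ (((A i).card * (B i).card : ℕ) : ℝ)) :
    (n : ℝ) ^ (4 - δ) ≤ (∑ i, ((A i).card : ℝ)) * p := by
  haveI : Fact p.Prime := ⟨hp⟩
  have hnpos : (0 : ℝ) < n := by exact_mod_cast hn
  have hY : 0 < (n : ℝ) ^ (2 - δ) := Real.rpow_pos_of_pos hnpos _
  -- all sets are non-empty
  have hne : ∀ i : Fin n, (A i).Nonempty ∧ (B i).Nonempty := by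
    intro i
    have h1 : 0 < (A i).card * (B i).card := by
      have : (0 : ℝ) < (((A i).card * (B i).card : ℕ) : ℝ) := hY.trans_le (hAB i)
      exact_mod_cast this
    refine ⟨Finset.card_pos.1 (Nat.pos_of_ne_zero fun h0 => ?_),
      Finset.card_pos.1 (Nat.pos_of_ne_zero fun h0 => ?_)⟩
    · rw [h0, zero_mul] at h1; exact lt_irrefl 0 h1
    · rw [h0, mul_zero] at h1; exact lt_irrefl 0 h1
  have hBsum : ∑ i, (B i).card ≤ p := by
    have := h.sum_card_right_le fun i => (hne i).1
    rwa [ZMod.card] at this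
  have hBsumR : (∑ i, ((B i).card : ℝ)) ≤ p := by exact_mod_cast hBsum
  -- Cauchy–Schwarz
  have hCS := Real.sum_sqrt_mul_sqrt_le (Finset.univ : Finset (Fin n))
    (f := fun i => ((A i).card : ℝ)) (g := fun i => ((B i).card : ℝ))
    (fun i => Nat.cast_nonneg _) (fun i => Nat.cast_nonneg _)
  have hterm : ∀ i : Fin n, Real.sqrt ((n : ℝ) ^ (2 - δ)) ≤
      Real.sqrt ((A i).card : ℝ) * Real.sqrt ((B i).card : ℝ) := by
    intro i
    rw [← Real.sqrt_mul (Nat.cast_nonneg _)]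
    exact Real.sqrt_le_sqrt (by have := hAB i; push_cast at this; exact this)
  have hlow : (n : ℝ) * Real.sqrt ((n : ℝ) ^ (2 - δ)) ≤
      Real.sqrt (∑ i, ((A i).card : ℝ)) * Real.sqrt (∑ i, ((B i).card : ℝ)) := by
    have h1 : ∑ _i : Fin n, Real.sqrt ((n : ℝ) ^ (2 - δ)) ≤
        ∑ i : Fin n, Real.sqrt ((A i).card : ℝ) * Real.sqrt ((B i).card : ℝ) :=
      Finset.sum_le_sum fun i _ => hterm i
    rw [Finset.sum_const, Finset.card_univ, Fintype.card_fin, nsmul_eq_mul] at h1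
    exact h1.trans hCS
  have hA0 : 0 ≤ ∑ i, ((A i).card : ℝ) := Finset.sum_nonneg fun i _ => Nat.cast_nonneg _
  have hup : Real.sqrt (∑ i, ((A i).card : ℝ)) * Real.sqrt (∑ i, ((B i).card : ℝ)) ≤
      Real.sqrt (∑ i, ((A i).card : ℝ)) * Real.sqrt p :=
    mul_le_mul_of_nonneg_left (Real.sqrt_le_sqrt hBsumR) (Real.sqrt_nonneg _)
  have hchain := hlow.trans hup
  have hsq := pow_le_pow_left₀ (by positivity) hchain 2
  have e1 : ((n : ℝ) * Real.sqrt ((n : ℝ) ^ (2 - δ))) ^ 2 = (n : ℝ) ^ (4 - δ) := by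
    rw [mul_pow, Real.sq_sqrt hY.le, show (4 - δ : ℝ) = 2 + (2 - δ) by ring, Real.rpow_add hnpos,
      Real.rpow_two]
  have e2 : (Real.sqrt (∑ i, ((A i).card : ℝ)) * Real.sqrt p) ^ 2 = (∑ i, ((A i).card : ℝ)) * p := by
    rw [mul_pow, Real.sq_sqrt hA0, Real.sq_sqrt (Nat.cast_nonneg _)]
  rwa [e1, e2] at hsq

/-- **Pattern poverty of witnesses**: in a witness of slice `δ` at level `n ≥ 1` (prime
`p ≤ n^{2+δ}`, SDPP, `|Aᵢ||Bᵢ| ≥ n^{2-δ}`), a pattern `B₀` some translate of which lies inside EVERY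
`Bᵢ` has `|B₀| ≤ n^{3δ}` (`|B₀|·n^{4-δ} ≤ |B₀|·(Σ|Aᵢ|)·p ≤ p² ≤ n^{4+2δ}`).  By `isSDPP_swap` the same
holds for the `Aᵢ`.  For `δ → 0` the blocks share no common sub-structure beyond size `n^{o(1)}`
(no common long progression, subcube, …), while each block has size `≈ n^{1-δ/2}`. -/
theorem common_subshape_card_le_of_witness {n p : ℕ} (hp : p.Prime) (hn : 1 ≤ n) {δ : ℝ}
    {A B : Fin n → Finset (ZMod p)} (h : IsSDPP A B)
    (hpn : (p : ℝ) ≤ (n : ℝ) ^ (2 + δ))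
    (hAB : ∀ i : Fin n, (n : ℝ) ^ (2 - δ) ≤ (((A i).card * (B i).card : ℕ) : ℝ))
    (B₀ : Finset (ZMod p)) (u : Fin n → ZMod p) (hB₀ : ∀ i : Fin n, u i +ᵥ B₀ ⊆ B i) :
    (B₀.card : ℝ) ≤ (n : ℝ) ^ (3 * δ) := by
  haveI : Fact p.Prime := ⟨hp⟩
  have hnpos : (0 : ℝ) < n := by exact_mod_cast hn
  have hpack := sum_card_mul_card_le_of_subshape h Finset.univ B₀ u fun i _ => hB₀ i
  rw [ZMod.card] at hpack
  have hpackR : (∑ i, ((A i).card : ℝ)) * (B₀.card : ℝ) ≤ p := by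
    have : (((∑ i, (A i).card) * B₀.card : ℕ) : ℝ) ≤ p := by exact_mod_cast hpack
    push_cast at this
    exact this
  have hCS := rpow_le_sum_card_mul_of_witness hp hn h hAB
  have hp0 : (0 : ℝ) ≤ p := Nat.cast_nonneg _
  have hB0 : (0 : ℝ) ≤ B₀.card := Nat.cast_nonneg _
  -- `|B₀| · n^{4-δ} ≤ p²`
  have h1 : (B₀.card : ℝ) * (n : ℝ) ^ (4 - δ) ≤ (p : ℝ) * p := by
    calc (B₀.card : ℝ) * (n : ℝ) ^ (4 - δ) ≤ (B₀.card : ℝ) * ((∑ i, ((A i).card : ℝ)) * p) :=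
          mul_le_mul_of_nonneg_left hCS hB0
      _ = ((∑ i, ((A i).card : ℝ)) * (B₀.card : ℝ)) * p := by ring
      _ ≤ (p : ℝ) * p := mul_le_mul_of_nonneg_right hpackR hp0
  have h2 : (p : ℝ) * p ≤ (n : ℝ) ^ (3 * δ) * (n : ℝ) ^ (4 - δ) := by
    have h3 : (p : ℝ) * p ≤ (n : ℝ) ^ (2 + δ) * (n : ℝ) ^ (2 + δ) := mul_le_mul hpn hpn hp0 (by positivity)
    have h4 : (n : ℝ) ^ (2 + δ) * (n : ℝ) ^ (2 + δ) = (n : ℝ) ^ (3 * δ) * (n : ℝ) ^ (4 - δ) := by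
      rw [← Real.rpow_add hnpos, ← Real.rpow_add hnpos]; congr 1; ring
    rw [← h4]; exact h3
  exact le_of_mul_le_mul_right (h1.trans h2) (Real.rpow_pos_of_pos hnpos _)


end Shapes

/-! ## §3 Conditional kill: the crux forces large `Val(ℤ/P)` at primes -/

/-- The case `ε ≤ 1` of `exists_prime_prattVal_ge_of_primeTwoFamilies`. -/
theorem exists_prime_prattVal_ge_aux (hT : FourierTwoFamiliesModP.PrimeTwoFamilies)
    {ε : ℝ} (hε : 0 < ε) (hε1 : ε ≤ 1) (N₀ : ℕ) :
    ∃ P : ℕ, ∃ _ : NeZero P, P.Prime ∧ N₀ ≤ P ∧ (P : ℝ) ^ (4 / 3 - ε) ≤ (prattVal (ZMod P) : ℝ) := by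
  have hδpos : 0 < ε / 4 := by positivity
  have hδ1 : ε / 4 ≤ 1 := by linarith
  obtain ⟨n₁, hn₁⟩ := exists_cornerFree_indexMaps_card_ge (ε / 4) hδpos hδ1
  obtain ⟨n, hn, p, hp, A, B, hW, hX, hpn, hAB⟩ :=
    hT (ε / 4) hδpos (n₁ + ⌈Real.exp (10 / ε)⌉₊ + N₀ + 2)
  have hn1nat : 1 < n := by omega
  have hnpos : (0 : ℝ) < n := by exact_mod_cast (show 0 < n by omega)
  have hn1 : (1 : ℝ) < n := by exact_mod_cast hn1nat
  have hLpos : 0 < Real.log n := Real.log_pos hn1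
  -- `ε · log n > 10`
  have hbig : 10 < ε * Real.log n := by
    have h1 : Real.exp (10 / ε) < n := by
      have h2 := Nat.le_ceil (Real.exp (10 / ε))
      have h3 : (⌈Real.exp (10 / ε)⌉₊ : ℝ) < n := by
        exact_mod_cast (show ⌈Real.exp (10 / ε)⌉₊ < n by omega)
      linarith
    have h4 := Real.log_lt_log (Real.exp_pos _) h1
    rw [Real.log_exp, div_lt_iff₀ hε] at h4
    linarith
  haveI : Fact p.Prime := ⟨hp⟩
  have hppos : (0 : ℝ) < p := by exact_mod_cast hp.pos
  -- `N₀ ≤ n ≤ p`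
  have hnp : n ≤ p := by
    have i : Fin n := ⟨0, by omega⟩
    have h1 : (A i).card * (B i).card ≤ p := by
      have := card_mul_card_le_of_dpp (H := ZMod p) (hW i)
      rwa [ZMod.card] at this
    have h2 : (n : ℝ) ≤ (n : ℝ) ^ (2 - ε / 4) := by
      calc (n : ℝ) = (n : ℝ) ^ (1 : ℝ) := (Real.rpow_one _).symm
        _ ≤ (n : ℝ) ^ (2 - ε / 4) := Real.rpow_le_rpow_of_exponent_le hn1.le (by linarith)
    have h3 : (n : ℝ) ≤ (p : ℝ) := by
      calc (n : ℝ) ≤ (n : ℝ) ^ (2 - ε / 4) := h2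
        _ ≤ (((A i).card * (B i).card : ℕ) : ℝ) := hAB i
        _ ≤ (p : ℝ) := by exact_mod_cast h1
    exact_mod_cast h3
  -- corner-free index maps and the CKSU family in `(ℤ/p)³`
  obtain ⟨ι₀, _inst1, _inst2, j₁, j₂, j₃, hι₀, hcf⟩ := hn₁ n (by omega)
  have hS := addSimultaneousTPP_of_sdpp hW hX j₁ j₂ j₃ hcf
  -- a PRIME modulus above the mixed-radix range `(3p)³` (Bertrand)
  have hMeq : (3 ^ 1 * ∏ _i : Fin 1, p) ^ 3 = 27 * p ^ 3 := by simp; ring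
  obtain ⟨P, hP, hMP, hP2M⟩ := Nat.exists_prime_lt_and_le_two_mul ((3 ^ 1 * ∏ _i : Fin 1, p) ^ 3)
    (by rw [hMeq]; have := hp.pos; positivity)
  haveI : NeZero P := ⟨hP.ne_zero⟩
  have hPpos : (0 : ℝ) < P := by exact_mod_cast hP.pos
  have hval := sum_card_mul_le_prattVal_zmod_of_addEquiv hS (k := 1) (m := fun _ => p)
    (fun _ => hp.pos) (AddEquiv.piUnique (fun _ : Fin 1 => ZMod p)).symm (N := P) hMP.le
  rw [Finset.sum_congr rfl (fun x _ => card_mul_card_mul_card_sdpp j₁ j₂ j₃ x)] at hval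
  -- `P ≥ N₀`
  have hNP : N₀ ≤ P := by
    rw [hMeq] at hMP
    have h1 : p ≤ p ^ 3 := Nat.le_self_pow (by norm_num) p
    have h2 : p ^ 3 ≤ 27 * p ^ 3 := Nat.le_mul_of_pos_left (p ^ 3) (by norm_num)
    omega
  refine ⟨P, ⟨hP.ne_zero⟩, hP, hNP, ?_⟩
  -- lower bound of the packing sum: each term is `≥ Y³`, `Y = n^{2-ε/4}`
  set Y : ℝ := (n : ℝ) ^ (2 - ε / 4) with hY
  have hYpos : 0 < Y := Real.rpow_pos_of_pos hnpos _
  have hterm : ∀ x : ι₀, Y ^ 3 ≤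
      ((#(A (j₁ x)) * #(B (j₁ x)) * (#(A (j₂ x)) * #(B (j₂ x))) * (#(A (j₃ x)) * #(B (j₃ x))) : ℕ) : ℝ) := by
    intro x
    have h1 := hAB (j₁ x)
    have h2 := hAB (j₂ x)
    have h3 := hAB (j₃ x)
    have h12 : Y * Y ≤ (((A (j₁ x)).card * (B (j₁ x)).card : ℕ) : ℝ) *
        (((A (j₂ x)).card * (B (j₂ x)).card : ℕ) : ℝ) :=
      mul_le_mul h1 h2 hYpos.le (hYpos.le.trans h1)
    have h123 : Y * Y * Y ≤ (((A (j₁ x)).card * (B (j₁ x)).card : ℕ) : ℝ) *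
        (((A (j₂ x)).card * (B (j₂ x)).card : ℕ) : ℝ) * (((A (j₃ x)).card * (B (j₃ x)).card : ℕ) : ℝ) :=
      mul_le_mul h12 h3 hYpos.le ((mul_pos hYpos hYpos).le.trans h12)
    calc Y ^ 3 = Y * Y * Y := by ring
      _ ≤ _ := h123
      _ = _ := by push_cast; ring
  have hsum : (Fintype.card ι₀ : ℝ) * Y ^ 3 ≤ (prattVal (ZMod P) : ℝ) := by
    have h1 : ∑ _x : ι₀, Y ^ 3 ≤ ∑ x : ι₀,
        ((#(A (j₁ x)) * #(B (j₁ x)) * (#(A (j₂ x)) * #(B (j₂ x))) * (#(A (j₃ x)) * #(B (j₃ x))) : ℕ) : ℝ) :=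
      Finset.sum_le_sum fun x _ => hterm x
    rw [Finset.sum_const, Finset.card_univ, nsmul_eq_mul] at h1
    have h2 : ((∑ x : ι₀, #(A (j₁ x)) * #(B (j₁ x)) * (#(A (j₂ x)) * #(B (j₂ x))) *
        (#(A (j₃ x)) * #(B (j₃ x))) : ℕ) : ℝ) ≤ (prattVal (ZMod P) : ℝ) := by exact_mod_cast hval
    push_cast at h2
    push_cast at h1
    linarith
  -- logarithms
  have hNpos : (0 : ℝ) < Fintype.card ι₀ := by
    by_contra h0
    push Not at h0
    have h0' : (Fintype.card ι₀ : ℝ) = 0 := le_antisymm h0 (Nat.cast_nonneg _)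
    rw [h0', mul_zero] at hι₀
    exact absurd hι₀ (not_le.2 (Real.rpow_pos_of_pos hnpos _))
  have hlogN : (2 - ε / 4) * Real.log n - Real.log 64 ≤ Real.log (Fintype.card ι₀) := by
    have h1 := Real.log_le_log (Real.rpow_pos_of_pos hnpos _) hι₀
    rw [Real.log_rpow hnpos, Real.log_mul (by norm_num) hNpos.ne'] at h1
    linarith
  have hVpos : (0 : ℝ) < prattVal (ZMod P) := lt_of_lt_of_le (mul_pos hNpos (pow_pos hYpos 3)) hsum
  have hlogV : Real.log (Fintype.card ι₀) + 3 * ((2 - ε / 4) * Real.log n) ≤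
      Real.log (prattVal (ZMod P)) := by
    have h1 := Real.log_le_log (mul_pos hNpos (pow_pos hYpos 3)) hsum
    rw [Real.log_mul hNpos.ne' (pow_pos hYpos 3).ne', Real.log_pow, hY, Real.log_rpow hnpos] at h1
    push_cast at h1
    linarith
  have hlogP : Real.log P ≤ Real.log 54 + 3 * ((2 + ε / 4) * Real.log n) := by
    have hPle : (P : ℝ) ≤ 54 * (p : ℝ) ^ 3 := by
      rw [hMeq] at hP2M
      have : (P : ℝ) ≤ ((2 * (27 * p ^ 3) : ℕ) : ℝ) := by exact_mod_cast hP2M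
      push_cast at this
      linarith
    have h1 := Real.log_le_log hPpos hPle
    rw [Real.log_mul (by norm_num) (pow_pos hppos 3).ne', Real.log_pow] at h1
    have h2 : Real.log p ≤ (2 + ε / 4) * Real.log n := by
      have := Real.log_le_log hppos hpn
      rwa [Real.log_rpow hnpos] at this
    push_cast at h1
    linarith
  -- numerics: `log 54 ≤ log 64 = 6 log 2 < 4.16`
  have hlog64 : Real.log 64 < 4.16 := by
    have : Real.log 64 = 6 * Real.log 2 := by
      rw [show (64 : ℝ) = 2 ^ 6 by norm_num, Real.log_pow]; push_cast; ring
    rw [this]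
    have := Real.log_two_lt_d9
    linarith
  have hlog54 : Real.log 54 < 4.16 :=
    lt_of_le_of_lt (Real.log_le_log (by norm_num) (by norm_num)) hlog64
  have hlog54nn : 0 ≤ Real.log 54 := Real.log_nonneg (by norm_num)
  -- the exponent count
  have hc0 : 0 < 4 / 3 - ε := by linarith
  have key : (4 / 3 - ε) * Real.log P ≤ Real.log (prattVal (ZMod P)) := by
    have h1 : (4 / 3 - ε) * Real.log P ≤ (4 / 3 - ε) * (Real.log 54 + 3 * ((2 + ε / 4) * Real.log n)) :=
      mul_le_mul_of_nonneg_left hlogP hc0.le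
    have h2 : (4 / 3 - ε) * Real.log 54 ≤ 4 / 3 * 4.16 := by
      have := mul_le_mul (show (4 / 3 - ε : ℝ) ≤ 4 / 3 by linarith) hlog54.le hlog54nn (by norm_num)
      linarith
    have h3 : (4 / 3 - ε) * (Real.log 54 + 3 * ((2 + ε / 4) * Real.log n)) =
        (4 / 3 - ε) * Real.log 54 + (8 - 5 * ε) * Real.log n - 3 / 4 * (ε * (ε * Real.log n)) := by
      ring
    have h4 : 0 ≤ ε * (ε * Real.log n) := by positivity
    have h5 : Real.log (Fintype.card ι₀) + 3 * ((2 - ε / 4) * Real.log n) =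
        Real.log (Fintype.card ι₀) + (6 - 3 / 4 * ε) * Real.log n := by ring
    nlinarith [hbig, hLpos, h1, h2, h3, h4, hlogV, hlogN, hlog64, mul_pos hε hLpos]
  calc (P : ℝ) ^ (4 / 3 - ε) = Real.exp (Real.log P * (4 / 3 - ε)) := Real.rpow_def_of_pos hPpos _
    _ ≤ Real.exp (Real.log (prattVal (ZMod P))) := Real.exp_le_exp.2 (by rw [mul_comm]; exact key)
    _ = (prattVal (ZMod P) : ℝ) := Real.exp_log hVpos

/-- **The crux forces `Val(ℤ/P) ≥ P^{4/3-ε}` at infinitely many PRIMES `P`** (Pratt 2024 Thm 4.7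
at prime moduli, for prime-cyclic two families): CKSU §6 lift on a Behrend corner-free index set
(tree `addSimultaneousTPP_of_sdpp`, `exists_cornerFree_indexMaps_card_ge`), the tree's mixed-radix
Freiman map into any modulus `N ≥ (3p)³` (`sum_card_mul_le_prattVal_zmod_of_addEquiv`) and
Bertrand's postulate for a prime `P ∈ ((3p)³, 2(3p)³]`; exponent count
`(8 - ε)·log n - log 64 ≥ (4/3 - ε)(log 54 + (6 + 3ε/4) log n)` once `ε log n > 10`. -/
theorem exists_prime_prattVal_ge_of_primeTwoFamilies (hT : FourierTwoFamiliesModP.PrimeTwoFamilies)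
    (ε : ℝ) (hε : 0 < ε) (N₀ : ℕ) :
    ∃ P : ℕ, ∃ _ : NeZero P, P.Prime ∧ N₀ ≤ P ∧ (P : ℝ) ^ (4 / 3 - ε) ≤ (prattVal (ZMod P) : ℝ) := by
  obtain ⟨P, _inst, hP, hNP, hle⟩ :=
    exists_prime_prattVal_ge_aux hT (lt_min hε one_pos) (min_le_right _ _) N₀
  refine ⟨P, ‹_›, hP, hNP, le_trans ?_ hle⟩
  have hP1 : (1 : ℝ) ≤ P := by exact_mod_cast hP.one_lt.le
  exact Real.rpow_le_rpow_of_exponent_le hP1 (by have := min_le_left ε 1; linarith)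

/-- **Conditional kill #1 (the sibling route's 4/3 rung refutes the crux)**:
`EisensteinValCertificates.PrimeFourThirdsSaving` (stmt-MatrixMultiplication-7790: `∃ δ > 0, K` with
`#{a+b+c=0} ≤ K p^{4/3-δ}` for every equilateral-trapezoid-free `(A,B,C) ⊂ ℤ/p`, `p` prime) implies
`¬ PrimeTwoFamilies`.  (`Val(ℤ/P) ≤ K P^{4/3-δ}` at all primes versus `≥ P^{4/3-δ/2}` at infinitely
many.)  The formal version of the route's kill criterion "PrimeFourThirdsSaving + Pratt Thm 4.7"; note
that the tree fact `pratt2024_thm47` alone yields composite moduli only. -/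
theorem primeTwoFamilies_false_of_primeFourThirdsSaving
    (hV : EisensteinValCertificates.PrimeFourThirdsSaving) :
    ¬ FourierTwoFamiliesModP.PrimeTwoFamilies := by
  intro hT
  obtain ⟨δ, hδ, K, hK⟩ := hV
  have hVal : ∀ q : ℕ, [NeZero q] → q.Prime →
      (prattVal (ZMod q) : ℝ) ≤ K * (q : ℝ) ^ ((4 : ℝ) / 3 - δ) := by
    intro q _ hq
    obtain ⟨A, B, C, hfree, hcard⟩ := exists_prattVal_eq (G := ZMod q)
    have h := hK q hq A B C hfree
    rw [← hcard]
    simpa [zeroSumTriples] using h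
  set K' : ℝ := max K 1 with hK'
  have hK'1 : (1 : ℝ) ≤ K' := le_max_right _ _
  have hK'pos : (0 : ℝ) < K' := by linarith
  obtain ⟨P, _inst, hP, hNP, hle⟩ :=
    exists_prime_prattVal_ge_of_primeTwoFamilies hT (δ / 2) (by positivity) (⌈K' ^ (2 / δ)⌉₊ + 1)
  have hPpos : (0 : ℝ) < P := by exact_mod_cast hP.pos
  have hup : (prattVal (ZMod P) : ℝ) ≤ K' * (P : ℝ) ^ ((4 : ℝ) / 3 - δ) :=
    (hVal P hP).trans (mul_le_mul_of_nonneg_right (le_max_left _ _) (Real.rpow_nonneg hPpos.le _))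
  have h1 : (P : ℝ) ^ (4 / 3 - δ / 2) ≤ K' * (P : ℝ) ^ ((4 : ℝ) / 3 - δ) := hle.trans hup
  have h2 : (P : ℝ) ^ (δ / 2) ≤ K' := by
    have h3 : (P : ℝ) ^ (4 / 3 - δ / 2) = (P : ℝ) ^ (δ / 2) * (P : ℝ) ^ ((4 : ℝ) / 3 - δ) := by
      rw [← Real.rpow_add hPpos]; congr 1; ring
    rw [h3] at h1
    exact le_of_mul_le_mul_right h1 (Real.rpow_pos_of_pos hPpos _)
  have h4 : K' ^ (2 / δ) < (P : ℝ) := by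
    have h5 := Nat.le_ceil (K' ^ (2 / δ))
    have h6 : (⌈K' ^ (2 / δ)⌉₊ : ℝ) < P := by
      exact_mod_cast (show ⌈K' ^ (2 / δ)⌉₊ < P by omega)
    linarith
  have hδ0 : δ ≠ 0 := hδ.ne'
  have h7 : K' < (P : ℝ) ^ (δ / 2) := by
    have h8 := Real.rpow_lt_rpow (Real.rpow_nonneg hK'pos.le _) h4 (by positivity : (0:ℝ) < δ / 2)
    have h9 : (2 / δ * (δ / 2) : ℝ) = 1 := by field_simp
    rwa [← Real.rpow_mul hK'pos.le, h9, Real.rpow_one] at h8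
  linarith

/-- The crux implies the all-abelian two-families hypothesis of the tree fact `pratt2024_thm47`
(`H := ℤ/p`). -/
theorem twoFamiliesAbelian_of_primeTwoFamilies (hT : FourierTwoFamiliesModP.PrimeTwoFamilies) :
    ∀ δ : ℝ, 0 < δ → ∀ n₀ : ℕ, ∃ n ≥ n₀, ∃ (H : Type) (_ : AddCommGroup H) (_ : Fintype H)
      (A B : Fin n → Finset H),
      (∀ i : Fin n, ∀ a ∈ A i, ∀ a' ∈ A i, ∀ b ∈ B i, ∀ b' ∈ B i,
          (a - a') + (b - b') = 0 → a = a' ∧ b = b') ∧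
      (∀ i j k : Fin n, ∀ a ∈ A i, ∀ a' ∈ A j, ∀ b ∈ B j, ∀ b' ∈ B k,
          (a - a') + (b - b') = 0 → i = k) ∧
      (Fintype.card H : ℝ) ≤ (n : ℝ) ^ (2 + δ) ∧
      ∀ i : Fin n, (n : ℝ) ^ (2 - δ) ≤ (((A i).card * (B i).card : ℕ) : ℝ) := by
  intro δ hδ n₀
  obtain ⟨n, hn, p, hp, A, B, hW, hX, hpn, hAB⟩ := hT δ hδ n₀
  haveI : Fact p.Prime := ⟨hp⟩
  exact ⟨n, hn, ZMod p, inferInstance, inferInstance, A, B, hW, hX, by rwa [ZMod.card], hAB⟩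

/-- **Conditional kill #2 (any `4/3 - ε` saving on `Val` over ALL large moduli refutes the crux)**,
straight from the tree theorem `pratt2024_thm47_holds` (Pratt 2024 Thm 4.7, proved in tree). -/
theorem primeTwoFamilies_false_of_valSaving
    (hV : ∃ ε : ℝ, 0 < ε ∧ ∃ N₀ : ℕ, ∀ N : ℕ, N₀ ≤ N → ∀ [NeZero N],
      (prattVal (ZMod N) : ℝ) < (N : ℝ) ^ (4 / 3 - ε)) :
    ¬ FourierTwoFamiliesModP.PrimeTwoFamilies := by
  intro hT
  obtain ⟨ε, hε, N₀, hN⟩ := hV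
  obtain ⟨N, _inst, hN₀, hle⟩ :=
    pratt2024_thm47_holds (twoFamiliesAbelian_of_primeTwoFamilies hT) ε hε N₀
  exact absurd hle (not_le.2 (hN N hN₀))


/-! ### §3c The route's kill link, checked: `PrimeCyclicPowerGain → ¬ PrimeTwoFamilies` -/

/-- Markov on a packing: if `Σ_{i} f i ≤ p` then fewer than `n/4` indices have `4p < f i · n`
(precisely `4 · #{i : 4p < f i · n} ≤ n`, and `< n` unless the bad set is empty). -/
theorem four_mul_card_filter_le {n p : ℕ} (f : Fin n → ℕ) (hf : ∑ i, f i ≤ p) :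
    4 * ((Finset.univ : Finset (Fin n)).filter (fun i => 4 * p < f i * n)).card ≤ n := by
  classical
  set bad := (Finset.univ : Finset (Fin n)).filter (fun i => 4 * p < f i * n) with hbad
  by_cases hb : bad.card = 0
  · rw [hb]; omega
  · -- `#bad · 4p < Σ_{bad} f i · n ≤ p · n`
    have h1 : bad.card * (4 * p) < ∑ i ∈ bad, f i * n := by
      have h2 : ∑ _i ∈ bad, 4 * p < ∑ i ∈ bad, f i * n :=
        Finset.sum_lt_sum_of_nonempty (Finset.card_pos.1 (Nat.pos_of_ne_zero hb))
          fun i hi => (Finset.mem_filter.1 hi).2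
      rwa [Finset.sum_const, smul_eq_mul] at h2
    have h3 : ∑ i ∈ bad, f i * n ≤ p * n := by
      rw [← Finset.sum_mul]
      exact Nat.mul_le_mul_right _ ((Finset.sum_le_sum_of_subset (Finset.filter_subset _ _)).trans hf)
    have h4 : bad.card * (4 * p) < p * n := h1.trans_le h3
    have hp : 0 < p := by
      rcases Nat.eq_zero_or_pos p with h0 | h0
      · rw [h0] at h4; simp at h4
      · exact h0
    have : 4 * bad.card < n := by
      by_contra hcon
      push Not at hcon
      have : p * n ≤ bad.card * (4 * p) := by nlinarith
      omega
    omega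

/-- **Conditional kill #3 = the route's own kill link `PowerGainRefutes`** (stmt-14312, a POSITIVE
route item: the landing belongs to a prover; this seat's sorry-free candidate `folder/PGR.lean`,
`powerGainRefutes : PowerGainRefutes`, is attached to that item as evidence): a fixed power saving
`n·s^{1+c} ≤ p` for balanced SDPP configurations in `ℤ/p` refutes the crux.  Bookkeeping: slice
`δ := c/(2(3+2c))`; Markov on the packings `Σ|Aᵢ|, Σ|Bᵢ| ≤ p` leaves `≥ n/2` indices with
`|Aᵢ|·n, |Bᵢ|·n ≤ 4p`, there `|Aᵢ|, |Bᵢ| ≥ n^{1-2δ}/4`; shrink (`IsSDPP.mono`), reindex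
(`IsSDPP.reindex`), apply the gain: `n^{c/2} ≤ 2·4^{1+c}`, false for `n` large. -/
theorem primeTwoFamilies_false_of_primeCyclicPowerGain
    (hPG : FourierTwoFamiliesModP.PrimeCyclicPowerGain) :
    ¬ FourierTwoFamiliesModP.PrimeTwoFamilies := by
  intro hT
  obtain ⟨c, hc, s₀, hgain⟩ := hPG
  -- the slice
  set δ : ℝ := c / (2 * (3 + 2 * c)) with hδ
  have h32 : 0 < 3 + 2 * c := by linarith
  have hδpos : 0 < δ := by positivity
  have hδE : c - δ * (3 + 2 * c) = c / 2 := by rw [hδ]; field_simp; ring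
  have hδ14 : δ < 1 / 4 := by
    rw [hδ, div_lt_iff₀ (by positivity)]; nlinarith
  have h12δ : 0 < 1 - 2 * δ := by linarith
  -- the constant to beat and the level
  set C : ℝ := 2 * (4 : ℝ) ^ (1 + c) with hC
  have hCpos : 0 < C := by positivity
  set T₁ : ℕ := ⌈C ^ (1 / (c / 2))⌉₊ with hT₁
  set T₂ : ℕ := ⌈((4 : ℝ) * (s₀ + 1)) ^ (1 / (1 - 2 * δ))⌉₊ with hT₂
  obtain ⟨n, hn, p, hp, A, B, hW, hX, hpn, hAB⟩ := hT δ hδpos (T₁ + T₂ + 2)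
  have hn1nat : 1 ≤ n := by omega
  have hnpos : (0 : ℝ) < n := by exact_mod_cast (show 0 < n by omega)
  -- `C < n^{c/2}` and `4(s₀+1) < n^{1-2δ}`
  have hbigC : C < (n : ℝ) ^ (c / 2) := by
    have h1 := Nat.le_ceil (C ^ (1 / (c / 2)))
    have h2 : (T₁ : ℝ) < n := by exact_mod_cast (show T₁ < n by omega)
    have h3 : C ^ (1 / (c / 2)) < n := by rw [hT₁] at h2; linarith
    have h4 := Real.rpow_lt_rpow (Real.rpow_nonneg hCpos.le _) h3 (by positivity : 0 < c / 2)
    rwa [← Real.rpow_mul hCpos.le, one_div_mul_cancel (by positivity), Real.rpow_one] at h4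
  have hbigS : (4 : ℝ) * (s₀ + 1) < (n : ℝ) ^ (1 - 2 * δ) := by
    have h0 : (0 : ℝ) ≤ 4 * (s₀ + 1) := by positivity
    have h1 := Nat.le_ceil (((4 : ℝ) * (s₀ + 1)) ^ (1 / (1 - 2 * δ)))
    have h2 : (T₂ : ℝ) < n := by exact_mod_cast (show T₂ < n by omega)
    have h3 : ((4 : ℝ) * (s₀ + 1)) ^ (1 / (1 - 2 * δ)) < n := by rw [hT₂] at h2; linarith
    have h4 := Real.rpow_lt_rpow (Real.rpow_nonneg h0 _) h3 h12δ
    rwa [← Real.rpow_mul h0, one_div_mul_cancel h12δ.ne', Real.rpow_one] at h4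
  haveI : Fact p.Prime := ⟨hp⟩
  have hS : IsSDPP A B := ⟨hW, hX⟩
  -- non-emptiness and the packings `Σ|Aᵢ| ≤ p`, `Σ|Bᵢ| ≤ p`
  have hY : 0 < (n : ℝ) ^ (2 - δ) := Real.rpow_pos_of_pos hnpos _
  have hne : ∀ i : Fin n, (A i).Nonempty ∧ (B i).Nonempty := by
    intro i
    have h1 : 0 < (A i).card * (B i).card := by
      have : (0 : ℝ) < (((A i).card * (B i).card : ℕ) : ℝ) := hY.trans_le (hAB i)
      exact_mod_cast this
    refine ⟨Finset.card_pos.1 (Nat.pos_of_ne_zero fun h0 => ?_),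
      Finset.card_pos.1 (Nat.pos_of_ne_zero fun h0 => ?_)⟩
    · rw [h0, zero_mul] at h1; exact lt_irrefl 0 h1
    · rw [h0, mul_zero] at h1; exact lt_irrefl 0 h1
  have hsumA : ∑ i, (A i).card ≤ p := by
    have := hS.sum_card_left_le fun i => (hne i).2
    rwa [ZMod.card] at this
  have hsumB : ∑ i, (B i).card ≤ p := by
    have := hS.sum_card_right_le fun i => (hne i).1
    rwa [ZMod.card] at this
  -- the good indices
  classical
  set good := (Finset.univ : Finset (Fin n)).filter
    (fun i => (A i).card * n ≤ 4 * p ∧ (B i).card * n ≤ 4 * p) with hgood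
  have hbadA := four_mul_card_filter_le (fun i => (A i).card) hsumA
  have hbadB := four_mul_card_filter_le (fun i => (B i).card) hsumB
  have hgood_card : n ≤ 2 * good.card := by
    -- complement of good ⊆ badA ∪ badB
    have hsub : (Finset.univ : Finset (Fin n)) ⊆ good ∪
        ((Finset.univ : Finset (Fin n)).filter (fun i => 4 * p < (A i).card * n) ∪
         (Finset.univ : Finset (Fin n)).filter (fun i => 4 * p < (B i).card * n)) := by
      intro i _
      by_cases hA : (A i).card * n ≤ 4 * p
      · by_cases hB : (B i).card * n ≤ 4 * p
        · exact Finset.mem_union_left _ (Finset.mem_filter.2 ⟨Finset.mem_univ _, hA, hB⟩)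
        · exact Finset.mem_union_right _ (Finset.mem_union_right _
            (Finset.mem_filter.2 ⟨Finset.mem_univ _, not_le.1 hB⟩))
      · exact Finset.mem_union_right _ (Finset.mem_union_left _
          (Finset.mem_filter.2 ⟨Finset.mem_univ _, not_le.1 hA⟩))
    have h1 := Finset.card_le_card hsub
    rw [Finset.card_univ, Fintype.card_fin] at h1
    have h2 : (good ∪
        ((Finset.univ : Finset (Fin n)).filter (fun i => 4 * p < (A i).card * n) ∪
         (Finset.univ : Finset (Fin n)).filter (fun i => 4 * p < (B i).card * n))).card ≤
        good.card + (((Finset.univ : Finset (Fin n)).filter (fun i => 4 * p < (A i).card * n)).card +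
          ((Finset.univ : Finset (Fin n)).filter (fun i => 4 * p < (B i).card * n)).card) :=
      (Finset.card_union_le _ _).trans (Nat.add_le_add_left (Finset.card_union_le _ _) _)
    have h3 := h1.trans h2
    omega
  -- sizes on good indices: `|Aᵢ|, |Bᵢ| ≥ n^{1-2δ}/4`
  set s : ℕ := ⌈(n : ℝ) ^ (1 - 2 * δ) / 4⌉₊ with hs_def
  have hs_low : (n : ℝ) ^ (1 - 2 * δ) / 4 ≤ s := Nat.le_ceil _
  have hs₀ : s₀ ≤ s := by
    have : (s₀ : ℝ) < s := by
      have : (s₀ : ℝ) + 1 < (n : ℝ) ^ (1 - 2 * δ) / 4 := by linarith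
      linarith
    exact_mod_cast this.le
  have hkey : ∀ i ∈ good, s ≤ (A i).card ∧ s ≤ (B i).card := by
    intro i hi
    obtain ⟨-, hA4, hB4⟩ := Finset.mem_filter.1 hi
    have hA4r : ((A i).card : ℝ) * n ≤ 4 * p := by exact_mod_cast hA4
    have hB4r : ((B i).card : ℝ) * n ≤ 4 * p := by exact_mod_cast hB4
    have hprod : (n : ℝ) ^ (2 - δ) ≤ ((A i).card : ℝ) * ((B i).card : ℝ) := by
      have := hAB i; push_cast at this; exact this
    have hp4 : (4 : ℝ) * p ≤ 4 * (n : ℝ) ^ (2 + δ) := by linarith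
    -- `|B i| · 4 n^{2+δ} ≥ |B i| · |A i| · n ≥ n^{2-δ} · n`, so `|B i| ≥ n^{1-2δ}/4`
    have e1 : (n : ℝ) ^ (2 - δ) * n = (n : ℝ) ^ (1 - 2 * δ) * (n : ℝ) ^ (2 + δ) := by
      rw [← Real.rpow_add hnpos, show (1 - 2 * δ + (2 + δ) : ℝ) = (2 - δ) + 1 by ring,
        Real.rpow_add hnpos, Real.rpow_one]
    have hpow : 0 < (n : ℝ) ^ (2 + δ) := Real.rpow_pos_of_pos hnpos _
    have hBlow : (n : ℝ) ^ (1 - 2 * δ) / 4 ≤ (B i).card := by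
      have h1 : (n : ℝ) ^ (2 - δ) * n ≤ ((B i).card : ℝ) * (4 * (n : ℝ) ^ (2 + δ)) := by
        calc (n : ℝ) ^ (2 - δ) * n ≤ ((A i).card : ℝ) * ((B i).card : ℝ) * n :=
              mul_le_mul_of_nonneg_right hprod hnpos.le
          _ = ((B i).card : ℝ) * (((A i).card : ℝ) * n) := by ring
          _ ≤ ((B i).card : ℝ) * (4 * p) := mul_le_mul_of_nonneg_left hA4r (Nat.cast_nonneg _)
          _ ≤ ((B i).card : ℝ) * (4 * (n : ℝ) ^ (2 + δ)) :=
              mul_le_mul_of_nonneg_left hp4 (Nat.cast_nonneg _)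
      rw [e1] at h1
      rw [div_le_iff₀ (by norm_num : (0 : ℝ) < 4)]
      have h2 : (n : ℝ) ^ (1 - 2 * δ) * (n : ℝ) ^ (2 + δ) ≤ (((B i).card : ℝ) * 4) * (n : ℝ) ^ (2 + δ) := by
        linarith
      exact le_of_mul_le_mul_right h2 hpow
    have hAlow : (n : ℝ) ^ (1 - 2 * δ) / 4 ≤ (A i).card := by
      have h1 : (n : ℝ) ^ (2 - δ) * n ≤ ((A i).card : ℝ) * (4 * (n : ℝ) ^ (2 + δ)) := by
        calc (n : ℝ) ^ (2 - δ) * n ≤ ((A i).card : ℝ) * ((B i).card : ℝ) * n :=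
              mul_le_mul_of_nonneg_right hprod hnpos.le
          _ = ((A i).card : ℝ) * (((B i).card : ℝ) * n) := by ring
          _ ≤ ((A i).card : ℝ) * (4 * p) := mul_le_mul_of_nonneg_left hB4r (Nat.cast_nonneg _)
          _ ≤ ((A i).card : ℝ) * (4 * (n : ℝ) ^ (2 + δ)) :=
              mul_le_mul_of_nonneg_left hp4 (Nat.cast_nonneg _)
      rw [e1] at h1
      rw [div_le_iff₀ (by norm_num : (0 : ℝ) < 4)]
      have h2 : (n : ℝ) ^ (1 - 2 * δ) * (n : ℝ) ^ (2 + δ) ≤ (((A i).card : ℝ) * 4) * (n : ℝ) ^ (2 + δ) := by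
        linarith
      exact le_of_mul_le_mul_right h2 hpow
    exact ⟨Nat.ceil_le.2 hAlow, Nat.ceil_le.2 hBlow⟩
  -- reindex the good pairs by `Fin m` and shrink them to size `s`
  set m : ℕ := good.card with hm
  let ι : Fin m → Fin n := fun j => (good.equivFin.symm j).1
  have hιmem : ∀ j, ι j ∈ good := fun j => (good.equivFin.symm j).2
  have hιinj : Function.Injective ι := by
    intro j j' h
    exact good.equivFin.symm.injective (Subtype.ext h)
  have hA' : ∀ j : Fin m, ∃ A' : Finset (ZMod p), A' ⊆ A (ι j) ∧ A'.card = s :=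
    fun j => Finset.exists_subset_card_eq (hkey _ (hιmem j)).1
  have hB' : ∀ j : Fin m, ∃ B' : Finset (ZMod p), B' ⊆ B (ι j) ∧ B'.card = s :=
    fun j => Finset.exists_subset_card_eq (hkey _ (hιmem j)).2
  choose A' hA'sub hA'card using hA'
  choose B' hB'sub hB'card using hB'
  have hS' : IsSDPP A' B' := (hS.reindex ι hιinj).mono hA'sub hB'sub
  -- the power gain
  have hgain' := hgain p hp m s A' B' hs₀ (fun j => ⟨hA'card j, hB'card j⟩) hS'.1 hS'.2
  -- numerics: `(n/2) · (n^{1-2δ}/4)^{1+c} ≤ m s^{1+c} ≤ p ≤ n^{2+δ}`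
  have hm2 : (n : ℝ) ≤ 2 * m := by exact_mod_cast hgood_card
  have hspos : (0 : ℝ) < (n : ℝ) ^ (1 - 2 * δ) / 4 := by positivity
  have h1 : ((n : ℝ) ^ (1 - 2 * δ) / 4) ^ (1 + c) ≤ (s : ℝ) ^ (1 + c) :=
    Real.rpow_le_rpow hspos.le hs_low (by linarith)
  have h2 : ((n : ℝ) ^ (1 - 2 * δ) / 4) ^ (1 + c) = (n : ℝ) ^ ((1 - 2 * δ) * (1 + c)) / (4 : ℝ) ^ (1 + c) := by
    rw [Real.div_rpow (Real.rpow_nonneg hnpos.le _) (by norm_num), ← Real.rpow_mul hnpos.le]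
  have h3 : (n : ℝ) / 2 * ((n : ℝ) ^ ((1 - 2 * δ) * (1 + c)) / (4 : ℝ) ^ (1 + c)) ≤ (n : ℝ) ^ (2 + δ) := by
    calc (n : ℝ) / 2 * ((n : ℝ) ^ ((1 - 2 * δ) * (1 + c)) / (4 : ℝ) ^ (1 + c))
        ≤ (m : ℝ) * (s : ℝ) ^ (1 + c) := by
          rw [← h2]
          exact mul_le_mul (by linarith) h1 (Real.rpow_nonneg hspos.le _) (Nat.cast_nonneg _)
      _ ≤ p := hgain'
      _ ≤ (n : ℝ) ^ (2 + δ) := hpn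
  -- rewrite as `n^{c/2} ≤ C`
  have h4pos : (0 : ℝ) < (4 : ℝ) ^ (1 + c) := by positivity
  have h4ne : (4 : ℝ) ^ (1 + c) ≠ 0 := h4pos.ne'
  have h4 : (n : ℝ) * (n : ℝ) ^ ((1 - 2 * δ) * (1 + c)) ≤ C * (n : ℝ) ^ (2 + δ) := by
    have h6 := mul_le_mul_of_nonneg_left h3 (show (0 : ℝ) ≤ 2 * (4 : ℝ) ^ (1 + c) by positivity)
    have e : 2 * (4 : ℝ) ^ (1 + c) * ((n : ℝ) / 2 * ((n : ℝ) ^ ((1 - 2 * δ) * (1 + c)) / (4 : ℝ) ^ (1 + c))) =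
        (n : ℝ) * (n : ℝ) ^ ((1 - 2 * δ) * (1 + c)) := by
      field_simp
    rw [e] at h6
    rw [hC]
    exact h6
  have e2 : (n : ℝ) * (n : ℝ) ^ ((1 - 2 * δ) * (1 + c)) = (n : ℝ) ^ (c / 2) * (n : ℝ) ^ (2 + δ) := by
    rw [← Real.rpow_add hnpos, ← hδE]
    have e3 : (n : ℝ) * (n : ℝ) ^ ((1 - 2 * δ) * (1 + c)) = (n : ℝ) ^ (1 + (1 - 2 * δ) * (1 + c)) := by
      rw [Real.rpow_add hnpos, Real.rpow_one]
    rw [e3]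
    congr 1; ring
  rw [e2] at h4
  have h5 : (n : ℝ) ^ (c / 2) ≤ C := le_of_mul_le_mul_right h4 (Real.rpow_pos_of_pos hnpos _)
  linarith


/-! ## §5 Tightness of §2: translates realise every slice `δ > 1/2` with ONE shape -/

section Translates
open scoped Pointwise
open Summit.MatrixMultiplication.MatrixMultiplication.Theorems.PrimeLogDecay.Negative
  (blk mem_blk blk_card blk_W blk_X natCast_inj_of_lt)

/-- Translate design, `A`-side: `A_i = i·s² + [0, s)` (as a `Fin s`-parametrised block). -/
def trA (p n s : ℕ) : Fin n → Fin s → ZMod p := fun i t => (((i : ℕ) * s ^ 2 + t : ℕ) : ZMod p)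

/-- Translate design, `B`-side: `B_i = i·s² + s·[0, s)`. -/
def trB (p n s : ℕ) : Fin n → Fin s → ZMod p := fun i u => (((i : ℕ) * s ^ 2 + s * u : ℕ) : ZMod p)

/-- No wrap-around: all the sums compared by (W)/(X) stay below `2ns²`. -/
theorem tr_sum_lt {n s : ℕ} (i j : Fin n) (t u : Fin s) :
    (i : ℕ) * s ^ 2 + t + ((j : ℕ) * s ^ 2 + s * u) < 2 * n * s ^ 2 := by
  have hi : (i : ℕ) + 1 ≤ n := i.isLt
  have hj : (j : ℕ) + 1 ≤ n := j.isLt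
  have ht : (t : ℕ) + 1 ≤ s := t.isLt
  have hu : (u : ℕ) + 1 ≤ s := u.isLt
  have h1 : ((i : ℕ) + 1) * s ^ 2 ≤ n * s ^ 2 := Nat.mul_le_mul_right _ hi
  have h2 : ((j : ℕ) + 1) * s ^ 2 ≤ n * s ^ 2 := Nat.mul_le_mul_right _ hj
  have h3 : s * ((u : ℕ) + 1) ≤ s * s := Nat.mul_le_mul_left _ hu
  nlinarith [h1, h2, h3, ht]

/-- A block value splits as `s²·(index) + (offset < s²)`. -/
theorem tr_offset_lt {s : ℕ} (t u : Fin s) : (t : ℕ) + s * u < s ^ 2 := by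
  have ht : (t : ℕ) + 1 ≤ s := t.isLt
  have hu : (u : ℕ) + 1 ≤ s := u.isLt
  have h3 : s * ((u : ℕ) + 1) ≤ s * s := Nat.mul_le_mul_left _ hu
  nlinarith [h3, ht]

/-- (X) for the translate design once `p > 2ns²`: compare the `s²`-quotients. -/
theorem tr_X {p n s : ℕ} (hs : 0 < s) (hp : 2 * n * s ^ 2 < p) :
    ∀ i j k : Fin n, ∀ t t' u u' : Fin s,
      trA p n s i t - trA p n s j t' + (trB p n s j u - trB p n s k u') = 0 → i = k := by
  intro i j k t t' u u' h
  simp only [trA, trB] at h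
  have h1 : ((((i : ℕ) * s ^ 2 + t + ((j : ℕ) * s ^ 2 + s * u)) : ℕ) : ZMod p) =
      ((((j : ℕ) * s ^ 2 + t' + ((k : ℕ) * s ^ 2 + s * u')) : ℕ) : ZMod p) := by
    push_cast at h ⊢
    linear_combination h
  rw [natCast_inj_of_lt ((tr_sum_lt i j t u).trans hp) ((tr_sum_lt j k t' u').trans hp)] at h1
  have hs2 : 0 < s ^ 2 := by positivity
  have e1 : (i : ℕ) * s ^ 2 + t + ((j : ℕ) * s ^ 2 + s * u) = s ^ 2 * (i + j) + (t + s * u) := by ring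
  have e2 : (j : ℕ) * s ^ 2 + t' + ((k : ℕ) * s ^ 2 + s * u') = s ^ 2 * (j + k) + (t' + s * u') := by
    ring
  rw [e1, e2] at h1
  have h2 := congrArg (· / s ^ 2) h1
  simp only [Nat.mul_add_div hs2, Nat.div_eq_of_lt (tr_offset_lt t u),
    Nat.div_eq_of_lt (tr_offset_lt t' u'), add_zero] at h2
  exact Fin.ext (by omega)

/-- (W) for the translate design once `p > 2ns²`: offsets `t + s·u` determine `(t, u)`. -/
theorem tr_W {p n s : ℕ} (hs : 0 < s) (hp : 2 * n * s ^ 2 < p) :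
    ∀ i : Fin n, ∀ t t' u u' : Fin s,
      trA p n s i t - trA p n s i t' + (trB p n s i u - trB p n s i u') = 0 → t = t' ∧ u = u' := by
  intro i t t' u u' h
  simp only [trA, trB] at h
  have h1 : ((((i : ℕ) * s ^ 2 + t + ((i : ℕ) * s ^ 2 + s * u)) : ℕ) : ZMod p) =
      ((((i : ℕ) * s ^ 2 + t' + ((i : ℕ) * s ^ 2 + s * u')) : ℕ) : ZMod p) := by
    push_cast at h ⊢
    linear_combination h
  rw [natCast_inj_of_lt ((tr_sum_lt i i t u).trans hp) ((tr_sum_lt i i t' u').trans hp)] at h1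
  have h2 : (t : ℕ) + s * u = t' + s * u' := by omega
  have hmod := congrArg (· % s) h2
  simp only [Nat.add_mul_mod_self_left, Nat.mod_eq_of_lt t.isLt, Nat.mod_eq_of_lt t'.isLt] at hmod
  refine ⟨Fin.ext hmod, Fin.ext ?_⟩
  rw [hmod] at h2
  exact Nat.eq_of_mul_eq_mul_left hs (by omega)

/-- `trA p n s i` is injective once `p > 2ns²`. -/
theorem trA_inj {p n s : ℕ} (hp : 2 * n * s ^ 2 < p) :
    ∀ i : Fin n, ∀ t t' : Fin s, trA p n s i t = trA p n s i t' → t = t' := by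
  intro i t t' h
  have hs : 0 < s := by have := t.isLt; omega
  let u0 : Fin s := ⟨0, hs⟩
  have hb : ∀ t : Fin s, (i : ℕ) * s ^ 2 + t < p := fun t => by
    have := tr_sum_lt i i t u0; omega
  simp only [trA] at h
  exact Fin.ext (by have := (natCast_inj_of_lt (hb t) (hb t')).1 h; omega)

/-- `trB p n s i` is injective once `p > 2ns²`. -/
theorem trB_inj {p n s : ℕ} (hp : 2 * n * s ^ 2 < p) :
    ∀ i : Fin n, ∀ u u' : Fin s, trB p n s i u = trB p n s i u' → u = u' := by
  intro i u u' h
  have hs : 0 < s := by have := u.isLt; omega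
  let t0 : Fin s := ⟨0, hs⟩
  have hb : ∀ u : Fin s, (i : ℕ) * s ^ 2 + s * u < p := fun u => by
    have := tr_sum_lt i i t0 u; omega
  simp only [trB] at h
  have h1 := (natCast_inj_of_lt (hb u) (hb u')).1 h
  exact Fin.ext (Nat.eq_of_mul_eq_mul_left hs (by omega))

/-- The `B`-blocks of the translate design are translates of ONE template. -/
theorem blk_trB_eq_vadd {p n s : ℕ} (i : Fin n) :
    blk (trB p n s) i = (((i : ℕ) * s ^ 2 : ℕ) : ZMod p) +ᵥ
      (Finset.univ.image fun u : Fin s => ((s * u : ℕ) : ZMod p)) := by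
  rw [Finset.vadd_finset_def, Finset.image_image]
  unfold blk
  congr 1
  funext u
  simp only [Function.comp, vadd_eq_add, trB]
  push_cast
  ring

/-- **The translate design, packaged**: at level `n ≥ 1` with block size `s ≥ 1` there is a
Bertrand prime `p ∈ (2ns², 4ns²]` for which the translates `Aᵢ = i·s² + [0,s)`, `Bᵢ = i·s² + s·[0,s)`
form an SDPP family in `ℤ/p` with ONE right shape and `|Aᵢ| = |Bᵢ| = s`. -/
theorem translate_design (n s : ℕ) (hn : 1 ≤ n) (hs : 0 < s) :
    ∃ p : ℕ, p.Prime ∧ 2 * n * s ^ 2 < p ∧ p ≤ 4 * n * s ^ 2 ∧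
      UsesRightShapes (blk (trB p n s)) 1 ∧ IsSDPP (blk (trA p n s)) (blk (trB p n s)) ∧
      ∀ i : Fin n, (blk (trA p n s) i).card = s ∧ (blk (trB p n s) i).card = s := by
  obtain ⟨p, hp, hMp, hp2M⟩ := Nat.exists_prime_lt_and_le_two_mul (2 * n * s ^ 2) (by positivity)
  refine ⟨p, hp, hMp, by linarith, ?_, ⟨blk_W _ _ (tr_W hs hMp), blk_X _ _ (tr_X hs hMp)⟩,
    blk_card _ _ (trA_inj hMp) (trB_inj hMp)⟩
  exact ⟨fun _ => Finset.univ.image fun u : Fin s => ((s * u : ℕ) : ZMod p), fun _ => 0,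
    fun i => (((i : ℕ) * s ^ 2 : ℕ) : ZMod p), fun i => blk_trB_eq_vadd i⟩

/-- **Singleton design** `Aᵢ = Bᵢ = {i}` (`i < n ≤ p`) in `ℤ/p`: clauses (W) and (X). -/
theorem singleton_WX (p n : ℕ) (hnp : n ≤ p) :
    (∀ i : Fin n, ∀ a ∈ ({((i : ℕ) : ZMod p)} : Finset (ZMod p)),
      ∀ a' ∈ ({((i : ℕ) : ZMod p)} : Finset (ZMod p)), ∀ b ∈ ({((i : ℕ) : ZMod p)} : Finset (ZMod p)),
      ∀ b' ∈ ({((i : ℕ) : ZMod p)} : Finset (ZMod p)), (a - a') + (b - b') = 0 → a = a' ∧ b = b') ∧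
    (∀ i j k : Fin n, ∀ a ∈ ({((i : ℕ) : ZMod p)} : Finset (ZMod p)),
      ∀ a' ∈ ({((j : ℕ) : ZMod p)} : Finset (ZMod p)), ∀ b ∈ ({((j : ℕ) : ZMod p)} : Finset (ZMod p)),
      ∀ b' ∈ ({((k : ℕ) : ZMod p)} : Finset (ZMod p)), (a - a') + (b - b') = 0 → i = k) := by
  refine ⟨fun i a ha a' ha' b hb b' hb' _ => ?_, fun i j k a ha a' ha' b hb b' hb' h0 => ?_⟩
  · rw [mem_singleton] at ha ha' hb hb'
    exact ⟨ha.trans ha'.symm, hb.trans hb'.symm⟩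
  · rw [mem_singleton] at ha ha' hb hb'
    subst ha ha' hb hb'
    have h1 : ((i : ℕ) : ZMod p) = ((k : ℕ) : ZMod p) := by
      have : ((i : ℕ) : ZMod p) - ((k : ℕ) : ZMod p) = 0 := by
        rw [← h0]; abel
      exact sub_eq_zero.1 this
    rw [ZMod.natCast_eq_natCast_iff'] at h1
    rw [Nat.mod_eq_of_lt (i.isLt.trans_le hnp), Nat.mod_eq_of_lt (k.isLt.trans_le hnp)] at h1
    exact Fin.ext h1

/-- The block size `s = ⌈n^{1-δ/2}⌉` for `δ < 2`, `n ≥ 1`: `n^{1-δ/2} ≤ s ≤ 2n^{1-δ/2}`, `s ≥ 1`,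
and `s² ≥ n^{2-δ}`, `s² ≤ 4n^{2-δ}`. -/
theorem blockSize_bounds {δ : ℝ} (hδ2 : δ < 2) {n : ℕ} (hn : 1 ≤ n) :
    0 < ⌈(n : ℝ) ^ (1 - δ / 2)⌉₊ ∧
    (n : ℝ) ^ (2 - δ) ≤ ((⌈(n : ℝ) ^ (1 - δ / 2)⌉₊ * ⌈(n : ℝ) ^ (1 - δ / 2)⌉₊ : ℕ) : ℝ) ∧
    ((⌈(n : ℝ) ^ (1 - δ / 2)⌉₊ : ℕ) : ℝ) ^ 2 ≤ 4 * (n : ℝ) ^ (2 - δ) := by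
  have hnpos : (0 : ℝ) < n := by exact_mod_cast hn
  have hn1 : (1 : ℝ) ≤ n := by exact_mod_cast hn
  have he0 : 0 ≤ 1 - δ / 2 := by linarith
  set s : ℕ := ⌈(n : ℝ) ^ (1 - δ / 2)⌉₊ with hs_def
  have hne1 : (1 : ℝ) ≤ (n : ℝ) ^ (1 - δ / 2) := Real.one_le_rpow hn1 he0
  have hs1 : (n : ℝ) ^ (1 - δ / 2) ≤ s := Nat.le_ceil _
  have hs2 : (s : ℝ) < (n : ℝ) ^ (1 - δ / 2) + 1 := Nat.ceil_lt_add_one (by positivity)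
  have hs3 : (s : ℝ) ≤ 2 * (n : ℝ) ^ (1 - δ / 2) := by linarith
  have hspos : 0 < s := by
    have : (0 : ℝ) < s := lt_of_lt_of_le (by linarith) hs1
    exact_mod_cast this
  have h4 : (n : ℝ) ^ (2 - δ) = (n : ℝ) ^ (1 - δ / 2) * (n : ℝ) ^ (1 - δ / 2) := by
    rw [← Real.rpow_add hnpos]; congr 1; ring
  refine ⟨hspos, ?_, ?_⟩
  · push_cast
    rw [h4]
    exact mul_le_mul hs1 hs1 (by positivity) (Nat.cast_nonneg _)
  · have h3 : (s : ℝ) ^ 2 ≤ (2 * (n : ℝ) ^ (1 - δ / 2)) ^ 2 :=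
      pow_le_pow_left₀ (Nat.cast_nonneg _) hs3 2
    nlinarith [h3, h4]

/-- A level `n ≥ max(n₀, 1)` with `C < n^κ` (for `κ > 0`). -/
theorem exists_level (n₀ : ℕ) (C κ : ℝ) (hC : 0 ≤ C) (hκ : 0 < κ) :
    ∃ n : ℕ, n₀ ≤ n ∧ 1 ≤ n ∧ C < (n : ℝ) ^ κ := by
  refine ⟨n₀ + ⌈C ^ (1 / κ)⌉₊ + 1, by omega, by omega, ?_⟩
  have h1 := Nat.le_ceil (C ^ (1 / κ))
  have h2 : (⌈C ^ (1 / κ)⌉₊ : ℝ) < ((n₀ + ⌈C ^ (1 / κ)⌉₊ + 1 : ℕ) : ℝ) := by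
    push_cast; linarith
  have h3 : C ^ (1 / κ) < ((n₀ + ⌈C ^ (1 / κ)⌉₊ + 1 : ℕ) : ℝ) := by linarith
  have h4 := Real.rpow_lt_rpow (Real.rpow_nonneg hC _) h3 hκ
  rwa [← Real.rpow_mul hC, one_div_mul_cancel hκ.ne', Real.rpow_one] at h4

/-- **Tightness of §2 (and the translate baseline of the crux)**: for every `δ > 1/2` the slice is
realised by designs with ONE right shape — for `δ < 2` the translates `A_i = i·s² + [0,s)`,
`B_i = i·s² + s·[0,s)`, `s = ⌈n^{1-δ/2}⌉`, in `ℤ/p` for a Bertrand prime `p ∈ (2ns², 4ns²]`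
(`p ≤ 16 n^{3-δ} ≤ n^{2+δ}` as soon as `n^{2δ-1} ≥ 16`); for `δ ≥ 2` singletons.  So the
threshold `1/2` in `not_rightShapedPrimeTwoFamiliesAt` is exact, and `PrimeTwoFamiliesAt δ` holds
for every `δ > 1/2` — the open range of the crux is `δ ∈ (0, 1/2]` (designs) versus `δ → 0`. -/
theorem rightShapedPrimeTwoFamiliesAt_one {δ : ℝ} (hδ : 1 / 2 < δ) :
    RightShapedPrimeTwoFamiliesAt 1 δ := by
  intro n₀
  by_cases hδ2 : 2 ≤ δ
  · -- singletons
    obtain ⟨p, hn₀p, hp⟩ := Nat.exists_infinite_primes (n₀ + 2)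
    haveI : Fact p.Prime := ⟨hp⟩
    refine ⟨p, by omega, p, hp, fun i => {((i : ℕ) : ZMod p)}, fun i => {((i : ℕ) : ZMod p)},
      ?_, (singleton_WX p p le_rfl).1, (singleton_WX p p le_rfl).2, ?_, ?_⟩
    · refine ⟨fun _ => {0}, fun _ => 0, fun i => ((i : ℕ) : ZMod p), fun i => ?_⟩
      rw [Finset.vadd_finset_singleton, vadd_eq_add, add_zero]
    · have hp1 : (1 : ℝ) ≤ p := by exact_mod_cast hp.one_lt.le
      calc (p : ℝ) = (p : ℝ) ^ (1 : ℝ) := (Real.rpow_one _).symm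
        _ ≤ (p : ℝ) ^ (2 + δ) := Real.rpow_le_rpow_of_exponent_le hp1 (by linarith)
    · intro i
      simp only [card_singleton, mul_one, Nat.cast_one]
      have hp1 : (1 : ℝ) ≤ p := by exact_mod_cast hp.one_lt.le
      exact Real.rpow_le_one_of_one_le_of_nonpos hp1 (by linarith)
  · push Not at hδ2
    -- the level `n`: beyond `n₀` and with `n^{2δ-1} > 16`
    obtain ⟨n, hn₀n, hn1nat, h16⟩ := exists_level n₀ 16 (2 * δ - 1) (by norm_num) (by linarith)
    have hnpos : (0 : ℝ) < n := by exact_mod_cast hn1nat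
    -- the block size and the design
    obtain ⟨hspos, hsize, hs2⟩ := blockSize_bounds hδ2 hn1nat
    obtain ⟨p, hp, -, hp4, hshape, hS, hcard⟩ := translate_design n _ hn1nat hspos
    refine ⟨n, hn₀n, p, hp, _, _, hshape, hS.1, hS.2, ?_, fun i => ?_⟩
    · -- host size: `p ≤ 4ns² ≤ 16 n^{3-δ} ≤ n^{2+δ}`
      have h1 : (p : ℝ) ≤ 4 * (n : ℝ) * ((⌈(n : ℝ) ^ (1 - δ / 2)⌉₊ : ℕ) : ℝ) ^ 2 := by
        exact_mod_cast hp4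
      have h6 : (n : ℝ) * (n : ℝ) ^ (2 - δ) = (n : ℝ) ^ (3 - δ) := by
        rw [show (3 - δ : ℝ) = 1 + (2 - δ) by ring, Real.rpow_add hnpos, Real.rpow_one]
      have h5 : 4 * (n : ℝ) * ((⌈(n : ℝ) ^ (1 - δ / 2)⌉₊ : ℕ) : ℝ) ^ 2 ≤ 16 * (n : ℝ) ^ (3 - δ) := by
        nlinarith [mul_le_mul_of_nonneg_left hs2 hnpos.le]
      have h7 : 16 * (n : ℝ) ^ (3 - δ) ≤ (n : ℝ) ^ (2 + δ) := by
        have h8 : (n : ℝ) ^ (2 + δ) = (n : ℝ) ^ (2 * δ - 1) * (n : ℝ) ^ (3 - δ) := by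
          rw [← Real.rpow_add hnpos]; congr 1; ring
        rw [h8]
        exact mul_le_mul_of_nonneg_right h16.le (Real.rpow_nonneg hnpos.le _)
      linarith
    · -- sizes: `|A_i||B_i| = s² ≥ n^{2-δ}`
      rw [(hcard i).1, (hcard i).2]
      exact hsize

/-- Hence every slice `δ > 1/2` of the crux HOLDS (translate baseline). -/
theorem primeTwoFamiliesAt_of_gt_half {δ : ℝ} (hδ : 1 / 2 < δ) : PrimeTwoFamiliesAt δ :=
  (rightShapedPrimeTwoFamiliesAt_one hδ).primeTwoFamiliesAt

end Translates

/-! ## §6 Load-bearing clauses: the crux with any ONE clause dropped is TRUE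

For an `∃`-design statement the disprover's load-bearing analysis is dual to the usual
`_false_without_` form: each of the four clauses — (W), (X), the host bound `p ≤ n^{2+δ}`, the size
bound `n^{2-δ} ≤ |Aᵢ||Bᵢ|` — can be dropped only at the price of triviality (an explicit cheap design
then works for EVERY `δ > 0`), so all four jointly carry the content and no attack may relax any. -/

section LoadBearing
open Summit.MatrixMultiplication.MatrixMultiplication.Theorems.PrimeLogDecay.Negative
  (blk mem_blk blk_card blk_W blk_X natCast_inj_of_lt lineA lineB line_W lineA_inj lineB_inj)

/-- The crux WITHOUT the size bound. -/
def PrimeTwoFamiliesWithoutSize : Prop :=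
  ∀ δ : ℝ, 0 < δ → ∀ n₀ : ℕ, ∃ n ≥ n₀, ∃ p : ℕ, p.Prime ∧ ∃ A B : Fin n → Finset (ZMod p),
    (∀ i : Fin n, ∀ a ∈ A i, ∀ a' ∈ A i, ∀ b ∈ B i, ∀ b' ∈ B i,
        (a - a') + (b - b') = 0 → a = a' ∧ b = b') ∧
    (∀ i j k : Fin n, ∀ a ∈ A i, ∀ a' ∈ A j, ∀ b ∈ B j, ∀ b' ∈ B k,
        (a - a') + (b - b') = 0 → i = k) ∧
    (p : ℝ) ≤ (n : ℝ) ^ (2 + δ)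

/-- Dropping the size bound trivialises the crux (singletons, `n = p`). -/
theorem primeTwoFamiliesWithoutSize_holds : PrimeTwoFamiliesWithoutSize := by
  intro δ hδ n₀
  obtain ⟨p, hn₀p, hp⟩ := Nat.exists_infinite_primes n₀
  refine ⟨p, hn₀p, p, hp, fun i => {((i : ℕ) : ZMod p)}, fun i => {((i : ℕ) : ZMod p)},
    (singleton_WX p p le_rfl).1, (singleton_WX p p le_rfl).2, ?_⟩
  have hp1 : (1 : ℝ) ≤ p := by exact_mod_cast hp.one_lt.le
  calc (p : ℝ) = (p : ℝ) ^ (1 : ℝ) := (Real.rpow_one _).symm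
    _ ≤ (p : ℝ) ^ (2 + δ) := Real.rpow_le_rpow_of_exponent_le hp1 (by linarith)

/-- The crux WITHOUT the host bound. -/
def PrimeTwoFamiliesWithoutHost : Prop :=
  ∀ δ : ℝ, 0 < δ → ∀ n₀ : ℕ, ∃ n ≥ n₀, ∃ p : ℕ, p.Prime ∧ ∃ A B : Fin n → Finset (ZMod p),
    (∀ i : Fin n, ∀ a ∈ A i, ∀ a' ∈ A i, ∀ b ∈ B i, ∀ b' ∈ B i,
        (a - a') + (b - b') = 0 → a = a' ∧ b = b') ∧
    (∀ i j k : Fin n, ∀ a ∈ A i, ∀ a' ∈ A j, ∀ b ∈ B j, ∀ b' ∈ B k,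
        (a - a') + (b - b') = 0 → i = k) ∧
    ∀ i : Fin n, (n : ℝ) ^ (2 - δ) ≤ (((A i).card * (B i).card : ℕ) : ℝ)

/-- Dropping the host bound trivialises the crux (translates in a Bertrand prime `p ≈ 4ns²`, i.e.
host exponent `3 - δ` instead of `2 + δ`: the whole difficulty is the exponent `2`). -/
theorem primeTwoFamiliesWithoutHost_holds : PrimeTwoFamiliesWithoutHost := by
  intro δ hδ n₀
  by_cases hδ2 : 2 ≤ δ
  · obtain ⟨n, hn, p, hp, A, B, -, hW, hX, -, hAB⟩ :=
      rightShapedPrimeTwoFamiliesAt_one (show 1 / 2 < δ by linarith) n₀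
    exact ⟨n, hn, p, hp, A, B, hW, hX, hAB⟩
  · push Not at hδ2
    have hn1 : 1 ≤ n₀ + 1 := by omega
    obtain ⟨hspos, hsize, -⟩ := blockSize_bounds hδ2 hn1
    obtain ⟨p, hp, -, -, -, hS, hcard⟩ := translate_design (n₀ + 1) _ hn1 hspos
    refine ⟨n₀ + 1, by omega, p, hp, _, _, hS.1, hS.2, fun i => ?_⟩
    rw [(hcard i).1, (hcard i).2]
    exact hsize

/-- The crux WITHOUT clause (X). -/
def PrimeTwoFamiliesWithoutX : Prop :=
  ∀ δ : ℝ, 0 < δ → ∀ n₀ : ℕ, ∃ n ≥ n₀, ∃ p : ℕ, p.Prime ∧ ∃ A B : Fin n → Finset (ZMod p),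
    (∀ i : Fin n, ∀ a ∈ A i, ∀ a' ∈ A i, ∀ b ∈ B i, ∀ b' ∈ B i,
        (a - a') + (b - b') = 0 → a = a' ∧ b = b') ∧
    (p : ℝ) ≤ (n : ℝ) ^ (2 + δ) ∧
    ∀ i : Fin n, (n : ℝ) ^ (2 - δ) ≤ (((A i).card * (B i).card : ℕ) : ℝ)

/-- Dropping (X) trivialises the crux (ONE direct pair `[0,s) ⊕ s·[0,s)` repeated `n` times in a
Bertrand prime `p ∈ (s², 2s²]`, `s = ⌈n^{1-δ/2}⌉`, `p ≤ 8n^{2-δ} ≤ n^{2+δ}`). -/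
theorem primeTwoFamiliesWithoutX_holds : PrimeTwoFamiliesWithoutX := by
  intro δ hδ n₀
  by_cases hδ2 : 2 ≤ δ
  · obtain ⟨n, hn, p, hp, A, B, -, hW, -, hpn, hAB⟩ :=
      rightShapedPrimeTwoFamiliesAt_one (show 1 / 2 < δ by linarith) n₀
    exact ⟨n, hn, p, hp, A, B, hW, hpn, hAB⟩
  · push Not at hδ2
    obtain ⟨n, hn₀n, hn1nat, h8⟩ := exists_level n₀ 8 (2 * δ) (by norm_num) (by linarith)
    have hnpos : (0 : ℝ) < n := by exact_mod_cast hn1nat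
    obtain ⟨hspos, hsize, hs2⟩ := blockSize_bounds hδ2 hn1nat
    set s : ℕ := ⌈(n : ℝ) ^ (1 - δ / 2)⌉₊ with hs_def
    obtain ⟨p, hp, hsp, hp2⟩ := Nat.exists_prime_lt_and_le_two_mul (s * s) (by positivity)
    have hsp' : s < p := lt_of_le_of_lt (Nat.le_mul_self s) hsp
    refine ⟨n, hn₀n, p, hp, blk (lineA p n s), blk (lineB p n s), blk_W _ _ (line_W hsp), ?_, ?_⟩
    · -- host: `p ≤ 2s² ≤ 8n^{2-δ} ≤ n^{2+δ}`
      have h1 : (p : ℝ) ≤ 2 * (s : ℝ) ^ 2 := by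
        have : (p : ℝ) ≤ ((2 * (s * s) : ℕ) : ℝ) := by exact_mod_cast hp2
        push_cast at this; nlinarith
      have h7 : 8 * (n : ℝ) ^ (2 - δ) ≤ (n : ℝ) ^ (2 + δ) := by
        have h9 : (n : ℝ) ^ (2 + δ) = (n : ℝ) ^ (2 * δ) * (n : ℝ) ^ (2 - δ) := by
          rw [← Real.rpow_add hnpos]; congr 1; ring
        rw [h9]
        exact mul_le_mul_of_nonneg_right h8.le (Real.rpow_nonneg hnpos.le _)
      linarith
    · intro i
      obtain ⟨hA, hB⟩ := blk_card _ _ (lineA_inj hsp') (lineB_inj hsp) i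
      rw [hA, hB]
      exact hsize

/-- Gapped blocks `Aᵢ = Bᵢ = 2iL + [0, L)` (for the (W)-free design). -/
def gapBlk (p n L : ℕ) : Fin n → Fin L → ZMod p := fun i t => ((2 * (i : ℕ) * L + t : ℕ) : ZMod p)

/-- No wrap-around for the gapped blocks: sums stay below `4nL`. -/
theorem gap_sum_lt {n L : ℕ} (i j : Fin n) (t u : Fin L) :
    2 * (i : ℕ) * L + t + (2 * (j : ℕ) * L + u) < 4 * n * L := by
  have hi : (i : ℕ) + 1 ≤ n := i.isLt
  have hj : (j : ℕ) + 1 ≤ n := j.isLt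
  have ht : (t : ℕ) + 1 ≤ L := t.isLt
  have hu : (u : ℕ) + 1 ≤ L := u.isLt
  have h1 : ((i : ℕ) + 1) * L ≤ n * L := Nat.mul_le_mul_right _ hi
  have h2 : ((j : ℕ) + 1) * L ≤ n * L := Nat.mul_le_mul_right _ hj
  nlinarith [h1, h2, ht, hu]

/-- (X) for the gapped blocks once `p > 4nL`: compare the `2L`-quotients. -/
theorem gap_X {p n L : ℕ} (hL : 0 < L) (hp : 4 * n * L < p) :
    ∀ i j k : Fin n, ∀ t t' u u' : Fin L,
      gapBlk p n L i t - gapBlk p n L j t' + (gapBlk p n L j u - gapBlk p n L k u') = 0 → i = k := by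
  intro i j k t t' u u' h
  simp only [gapBlk] at h
  have h1 : (((2 * (i : ℕ) * L + t + (2 * (j : ℕ) * L + u)) : ℕ) : ZMod p) =
      (((2 * (j : ℕ) * L + t' + (2 * (k : ℕ) * L + u')) : ℕ) : ZMod p) := by
    push_cast at h ⊢
    linear_combination h
  rw [natCast_inj_of_lt ((gap_sum_lt i j t u).trans hp) ((gap_sum_lt j k t' u').trans hp)] at h1
  have hL2 : 0 < 2 * L := by omega
  have e1 : 2 * (i : ℕ) * L + t + (2 * (j : ℕ) * L + u) = 2 * L * (i + j) + (t + u) := by ring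
  have e2 : 2 * (j : ℕ) * L + t' + (2 * (k : ℕ) * L + u') = 2 * L * (j + k) + (t' + u') := by ring
  rw [e1, e2] at h1
  have h2 := congrArg (· / (2 * L)) h1
  have ht : (t : ℕ) + u < 2 * L := by have := t.isLt; have := u.isLt; omega
  have ht' : (t' : ℕ) + u' < 2 * L := by have := t'.isLt; have := u'.isLt; omega
  simp only [Nat.mul_add_div hL2, Nat.div_eq_of_lt ht, Nat.div_eq_of_lt ht', add_zero] at h2
  exact Fin.ext (by omega)

/-- `gapBlk p n L i` is injective once `p > 4nL`. -/
theorem gapBlk_inj {p n L : ℕ} (hp : 4 * n * L < p) :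
    ∀ i : Fin n, ∀ t t' : Fin L, gapBlk p n L i t = gapBlk p n L i t' → t = t' := by
  intro i t t' h
  have hb : ∀ t : Fin L, 2 * (i : ℕ) * L + t < p := fun t => by
    have := gap_sum_lt i i t t; omega
  simp only [gapBlk] at h
  exact Fin.ext (by have := (natCast_inj_of_lt (hb t) (hb t')).1 h; omega)

/-- The crux WITHOUT clause (W). -/
def PrimeTwoFamiliesWithoutW : Prop :=
  ∀ δ : ℝ, 0 < δ → ∀ n₀ : ℕ, ∃ n ≥ n₀, ∃ p : ℕ, p.Prime ∧ ∃ A B : Fin n → Finset (ZMod p),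
    (∀ i j k : Fin n, ∀ a ∈ A i, ∀ a' ∈ A j, ∀ b ∈ B j, ∀ b' ∈ B k,
        (a - a') + (b - b') = 0 → i = k) ∧
    (p : ℝ) ≤ (n : ℝ) ^ (2 + δ) ∧
    ∀ i : Fin n, (n : ℝ) ^ (2 - δ) ≤ (((A i).card * (B i).card : ℕ) : ℝ)

/-- Dropping (W) trivialises the crux (gapped blocks `Aᵢ = Bᵢ = 2iL + [0,L)`, `L = ⌈n^{1-δ/2}⌉`,
Bertrand prime `p ∈ (4nL, 8nL]`, `p ≤ 16n^{2-δ/2} ≤ n^{2+δ}`; the sumsets `Aᵢ + Bⱼ = 2(i+j)L + [0,2L)`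
are disjoint for distinct `i + j`). -/
theorem primeTwoFamiliesWithoutW_holds : PrimeTwoFamiliesWithoutW := by
  intro δ hδ n₀
  by_cases hδ2 : 2 ≤ δ
  · obtain ⟨n, hn, p, hp, A, B, -, -, hX, hpn, hAB⟩ :=
      rightShapedPrimeTwoFamiliesAt_one (show 1 / 2 < δ by linarith) n₀
    exact ⟨n, hn, p, hp, A, B, hX, hpn, hAB⟩
  · push Not at hδ2
    obtain ⟨n, hn₀n, hn1nat, h16⟩ := exists_level n₀ 16 (3 * δ / 2) (by norm_num) (by positivity)
    have hnpos : (0 : ℝ) < n := by exact_mod_cast hn1nat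
    have hn1 : (1 : ℝ) ≤ n := by exact_mod_cast hn1nat
    obtain ⟨hLpos, hsize, -⟩ := blockSize_bounds hδ2 hn1nat
    set L : ℕ := ⌈(n : ℝ) ^ (1 - δ / 2)⌉₊ with hL_def
    have hL1 : (n : ℝ) ^ (1 - δ / 2) ≤ L := Nat.le_ceil _
    have hL2 : (L : ℝ) < (n : ℝ) ^ (1 - δ / 2) + 1 := Nat.ceil_lt_add_one (by positivity)
    have hne1 : (1 : ℝ) ≤ (n : ℝ) ^ (1 - δ / 2) := Real.one_le_rpow hn1 (by linarith)
    obtain ⟨p, hp, hMp, hp2⟩ := Nat.exists_prime_lt_and_le_two_mul (4 * n * L) (by positivity)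
    refine ⟨n, hn₀n, p, hp, blk (gapBlk p n L), blk (gapBlk p n L), blk_X _ _ (gap_X hLpos hMp),
      ?_, ?_⟩
    · -- host: `p ≤ 8nL ≤ 16 n^{2-δ/2} ≤ n^{2+δ}`
      have h1 : (p : ℝ) ≤ 8 * (n : ℝ) * L := by
        have : (p : ℝ) ≤ ((2 * (4 * n * L) : ℕ) : ℝ) := by exact_mod_cast hp2
        push_cast at this; linarith
      have h2 : 8 * (n : ℝ) * L ≤ 16 * (n : ℝ) ^ (2 - δ / 2) := by
        have h3 : (n : ℝ) * (n : ℝ) ^ (1 - δ / 2) = (n : ℝ) ^ (2 - δ / 2) := by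
          rw [show (2 - δ / 2 : ℝ) = 1 + (1 - δ / 2) by ring, Real.rpow_add hnpos, Real.rpow_one]
        nlinarith [mul_le_mul_of_nonneg_left hL2.le hnpos.le, mul_le_mul_of_nonneg_left hne1 hnpos.le]
      have h7 : 16 * (n : ℝ) ^ (2 - δ / 2) ≤ (n : ℝ) ^ (2 + δ) := by
        have h9 : (n : ℝ) ^ (2 + δ) = (n : ℝ) ^ (3 * δ / 2) * (n : ℝ) ^ (2 - δ / 2) := by
          rw [← Real.rpow_add hnpos]; congr 1; ring
        rw [h9]
        exact mul_le_mul_of_nonneg_right h16.le (Real.rpow_nonneg hnpos.le _)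
      linarith
    · intro i
      obtain ⟨hA, -⟩ := blk_card _ _ (gapBlk_inj hMp) (gapBlk_inj hMp) i
      rw [hA]
      exact hsize

end LoadBearing

/-! ## §4 Why the crux resists (no theorem; the provers' briefing)

* An unconditional `¬ PrimeTwoFamilies` is `¬`(CKSU Conj. 4.7 in prime cyclic hosts); by Umans' cyclic
  reduction (Pratt arXiv:2309.03878 p. 10; route item `CyclicReduction`) it would refute the all-abelian
  two-families conjecture, open since 2005.  Searches 2026-08-16 (this seat; `lit citing arxiv:2309.03878
  --since 2024`: 5 works, all on skew corners / unrelated; galaxy "simultaneous double product": CKSU05 +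
  Stothers' thesis only; `ledger negatives`: 4 MM entries, none on SDPP) found no refutation or proof.
* Counting cannot bite: a witness of slice `δ` has density `ns/p ≈ n^{-3δ/2}` and `(W)`-slack
  `s²/p ≈ n^{-2δ}`, consistent with `α ≤ β`, `α + 2 ≤ 2β` (CKSU Prop. "25"), HalfDensity
  (`2ns² ≤ p(s+1)`) and every removal-type `o(1)` statement (`PrimeDensityDecay` does NOT refute the crux;
  only a POWER saving does — route item `PowerGainRefutes`, `δ < c/(3+2c)`).
* Known designs in `ℤ/p` (calibration, from the tree's `FourierTwoFamiliesPrimeCyclicWall_refuted` digit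
  designs and translates): radix-`M` digit designs (`n = C(2l,l)`, `s = (M-2)^l`, `p ≈ 2M^{2l}`) have
  `(α, β) = (log₂(M-2), log₂ M)·(1+o(1))`, i.e. slice `δ = max(2 - log₂(M-2), log₂ M - 2) + o(1)`:
  `M = 5` gives `δ ≈ 0.415`; mixing radices 5 and 6 across digit positions (products, CKSU Lemma "21")
  should give `≈ 0.36` (not formalised); translates give exactly `δ > 1/2` (§2/§5).  In tori CKSU
  Prop. "24" with `m = 4, 5` mixed reaches `δ ≈ 0.18`, but the digit transport to `ℤ/p` inflates `β`.
  Nothing known separates `δ_c := inf {δ : PrimeTwoFamiliesAt δ} ∈ [0, 0.415]` from `0`.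
* Structural reading of the clauses for constructors: (X) at `(i,k,k)` says `A_k` is ISOLATED inside
  `X = ⋃ A_i` by its own difference neighbourhood, `X ∩ (A_k + B_k - B_k) = A_k` (this is the engine of
  §2); the sumsets `S_i = A_i + B_i` (each of size `n^{2-δ}`, total `n^{3-δ} ≫ p`) are NOT required to
  be disjoint and in all dense designs known they overlap with multiplicity `≈ n^{1-2δ}` (digit designs:
  all `S_i` coincide) — a witness is a family of `n` near-factorisations `A_i ⊕ B_i` of heavily
  overlapping sets, pairwise non-translate on both sides (§2), sharing no sub-pattern beyond `n^{3δ}` (§2b).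
* The only structural obstructions in print: slice rank / tricoloured sum-free sets (vacuous in `ℤ/p`,
  exponent `p`; barrier `TricoloredSumFreeBarrier`'s declared blind spot) and Pratt's `Val` programme
  (§3 makes it a checked kill criterion; its skew-corner proxy is dead — Beker arXiv:2404.07380,
  arXiv:2402.19169 — so `PrimeFourThirdsSaving` itself is wide open, and is FALSE if the crux holds).
* Hypothesis mutation (rattack seat, re-checked): drop (X) ⇒ true (one direct pair repeated); drop (W) ⇒
  true; drop `p ≤ n^{2+δ}` ⇒ true by translates at `p ≈ 4n^{3-δ}`; drop the size bound ⇒ true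
  (singletons).  Every clause is load-bearing for falsity-resistance; none can be dropped by a disprover.
-/


end Summit.MatrixMultiplication.MatrixMultiplication.Cruxes.PrimeTwoFamilies.Disproof
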